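import Literature.Probability.LatticeModels.SquareTilingCrosscut
import Literature.Probability.LatticeModels.SquareTilingModulusLimsup
import HarnessLib

/-!
# Square tilings of lattice domains, V: the holomorphic limit of the conjugate pairs

Topic: Probability / LatticeModels. Fifth file of the proof of [GP19] Corollary 4.15
(`SquareTilingModulus.lean`, `…Proofs.lean`, `…Limsup.lean`, `SquareTilingConjugate.lean`,
`SquareTilingCrosscut.lean`), towards the lower half `lim inf_n R^eff_n ≥ d_Ω(T, B)`: along a
subsequence of the dyadic meshes the potentials `h_n` and their conjugates `h'_n` (based at the
square of a fixed point `c⋆ ∈ Ω`) converge locally uniformly on `Ω` to `v` and `u`, and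
`f = u + i v` is holomorphic on `Ω` with `∫∫_Ω ‖f'‖² ≤ lim 𝒞(T_n ↔ B_n)` ([GP19] §4.1: the
discrete Cauchy–Riemann relation (CRd) passes to the limit; Fatou as in Theorem 4.6).

* §L1 a squashing homeomorphism `sqz : ℝ → (0,1)` (to extract subsequences of the unbounded
  conjugates with the `[0,1]`-valued extraction lemma `exists_subseq_tendstoLocallyUniformly`);
* §L2 the conjugate in the bulk: step bounds (`abs_dualPot_step_le`), the local Lipschitz bound
  (`exists_forall_abs_dualPot_sub_le_mul_dist`, from Theorem 4.3), (CRd) as an identity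
  (`dualPot_step_eq`) and second-difference bounds (`exists_forall_abs_dualPot_second_diff_le`);
* §L3 local boundedness of the conjugates by chaining the Lipschitz bound along a path from `c⋆`
  (`exists_local_bound_dualPot`);
* §L4 the joint extraction and the holomorphic limit (`exists_holomorphic_limit`): `u` is `C¹`
  with `∇u = (v_y, -vₓ)` by the generic `exists_partialDeriv_limit` /
  `hasFDerivAt_of_quotient_bounds` of `…Limsup.lean` and (CRd), hence `f = u + iv` is holomorphic
  (`hasDerivAt_of_cr`) with `‖f'‖ = ‖∇v‖` (`norm_smul_reCLM_add_smul_imCLM`).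

Everything here is proved; no named fact is introduced.

## References

* [GeorgakopoulosPanagiotis2019] A. Georgakopoulos, C. Panagiotis, *Convergence of square tilings
  to the Riemann map*, arXiv:1910.06886 (2019), §4.1 (Thm 4.3, (CRd)), Thm 4.6.
-/

noncomputable section

namespace Literature.Probability.LatticeModels

open _root_.Filter _root_.Set _root_.Metric SimpleGraph
open scoped ENNReal NNReal _root_.Topology
open Literature.Probability.Percolation

namespace SquareTiling

/-! ### §L1. A squashing transform `ℝ → (0,1)` -/

section Squash

/-- The squashing map `x ↦ 1/2 + arctan x / π`, a `1`-Lipschitz increasing bijection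
`ℝ → (0, 1)`; used to apply the `[0,1]`-valued extraction lemma
`exists_subseq_tendstoLocallyUniformly` to the (unbounded) conjugates. [folklore] -/
def sqz (x : ℝ) : ℝ := 1 / 2 + Real.arctan x / Real.pi

/-- The inverse of `sqz` on `(0, 1)`. [folklore] -/
def unsqz (y : ℝ) : ℝ := Real.tan (Real.pi * (y - 1 / 2))

/-- `sqz` takes values in `(0, 1)`. [folklore] -/
theorem sqz_mem_Ioo (x : ℝ) : sqz x ∈ Ioo (0 : ℝ) 1 := by
  have hπ := Real.pi_pos
  have h1 := Real.arctan_lt_pi_div_two x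
  have h2 := Real.neg_pi_div_two_lt_arctan x
  unfold sqz
  constructor
  · rw [show (1 : ℝ) / 2 + Real.arctan x / Real.pi = (Real.pi / 2 + Real.arctan x) / Real.pi by field_simp]
    exact div_pos (by linarith) hπ
  · rw [show (1 : ℝ) / 2 + Real.arctan x / Real.pi = (Real.pi / 2 + Real.arctan x) / Real.pi by field_simp,
      div_lt_one hπ]
    linarith

/-- `sqz` takes values in `[0, 1]`. [folklore] -/
theorem sqz_mem_Icc (x : ℝ) : sqz x ∈ Icc (0 : ℝ) 1 := Ioo_subset_Icc_self (sqz_mem_Ioo x)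

/-- `sqz` is strictly increasing. [folklore] -/
theorem sqz_strictMono : StrictMono sqz := fun x y hxy => by
  unfold sqz
  have := Real.arctan_strictMono hxy
  have hπ := Real.pi_pos
  gcongr

/-- `sqz` is `1`-Lipschitz (indeed `1/π`-Lipschitz). [folklore] -/
theorem abs_sqz_sub_sqz_le (x y : ℝ) : |sqz x - sqz y| ≤ |x - y| := by
  have hπ := Real.pi_pos
  have hL : LipschitzWith 1 Real.arctan := by
    refine lipschitzWith_of_nnnorm_deriv_le Real.differentiable_arctan fun t => ?_
    rw [Real.deriv_arctan]
    have h1 : 0 ≤ 1 / (1 + t ^ 2) := by positivity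
    have h2 : 1 / (1 + t ^ 2) ≤ 1 := by rw [div_le_one (by positivity)]; nlinarith
    rw [← NNReal.coe_le_coe, coe_nnnorm, Real.norm_eq_abs, abs_of_nonneg h1]
    exact h2
  have h := hL.dist_le_mul x y
  rw [NNReal.coe_one, one_mul, Real.dist_eq, Real.dist_eq] at h
  unfold sqz
  rw [show (1 : ℝ) / 2 + Real.arctan x / Real.pi - (1 / 2 + Real.arctan y / Real.pi) =
    (Real.arctan x - Real.arctan y) / Real.pi by ring, abs_div, abs_of_pos hπ, div_le_iff₀ hπ]
  calc |Real.arctan x - Real.arctan y| ≤ |x - y| := h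
    _ = |x - y| * 1 := (mul_one _).symm
    _ ≤ |x - y| * Real.pi := by gcongr; linarith [Real.pi_gt_three]

/-- `unsqz` inverts `sqz`. [folklore] -/
theorem unsqz_sqz (x : ℝ) : unsqz (sqz x) = x := by
  unfold unsqz sqz
  have hπ := Real.pi_pos.ne'
  rw [show Real.pi * (1 / 2 + Real.arctan x / Real.pi - 1 / 2) = Real.arctan x by field_simp; ring]
  exact Real.tan_arctan x

/-- `sqz` inverts `unsqz` on `(0, 1)`. [folklore] -/
theorem sqz_unsqz {y : ℝ} (hy : y ∈ Ioo (0 : ℝ) 1) : sqz (unsqz y) = y := by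
  unfold unsqz sqz
  have hπ := Real.pi_pos
  rw [Real.arctan_tan (by nlinarith [hy.1]) (by nlinarith [hy.2])]
  field_simp
  ring

/-- `unsqz` is continuous on `(0, 1)`. [folklore] -/
theorem continuousOn_unsqz : ContinuousOn unsqz (Ioo (0 : ℝ) 1) := by
  unfold unsqz
  refine Real.continuousOn_tan_Ioo.comp (by fun_prop) fun y hy => ?_
  have hπ := Real.pi_pos
  constructor <;> nlinarith [hy.1, hy.2]

/-- `unsqz` is uniformly continuous on compact sub-intervals of `(0, 1)`. [folklore] -/
theorem uniformContinuousOn_unsqz {a b : ℝ} (ha : 0 < a) (hb : b < 1) :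
    UniformContinuousOn unsqz (Icc a b) :=
  isCompact_Icc.uniformContinuousOn_of_continuous (continuousOn_unsqz.mono fun _ hy => ⟨ha.trans_le hy.1, hy.2.trans_lt hb⟩)

end Squash



/-! ### §L2. The conjugate in the bulk: inner squares, step bounds, Lipschitz and difference bounds -/

section ConjugateBulk

open WeakBeurling

variable {Ω : Set ℂ} {δ : ℝ}

/-- Step flux of a left step. [folklore] -/
theorem stepFlux_left_eq (jh jv : Site 2 → ℝ) (x : Site 2) :
    stepFlux jh jv x (x - Pi.single 0 1) = jv (x - Pi.single 0 1 - Pi.single 1 1) := by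
  unfold stepFlux
  have c0 : (x - Pi.single 0 1 : Site 2) 0 = x 0 - 1 := by simp
  have c1 : (x - Pi.single 0 1 : Site 2) 1 = x 1 := by simp
  simp [c0, c1]
  omega

/-- Step flux of a down step. [folklore] -/
theorem stepFlux_down_eq (jh jv : Site 2 → ℝ) (x : Site 2) :
    stepFlux jh jv x (x - Pi.single 1 1) = -jh (x - Pi.single 1 1 - Pi.single 0 1) := by
  unfold stepFlux
  have c0 : (x - Pi.single 1 1 : Site 2) 0 = x 0 := by simp
  have c1 : (x - Pi.single 1 1 : Site 2) 1 = x 1 - 1 := by simp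
  simp [c0, c1]
  omega

/-- Across the left side: `h'(x - e₀) - h'(x) = h(x) - h(x + e₁)`. [folklore] -/
theorem stepFlux_left_cur (h : Site 2 → ℝ) (x : Site 2) :
    stepFlux (curH Ω δ h) (curV Ω δ h) x (x - Pi.single 0 1) = cur Ω δ h x (x + Pi.single 1 1) := by
  rw [stepFlux_left_eq, curV]
  congr 1 <;> rw [one_eq_single_add_single] <;> abel

/-- Across the bottom side: `h'(x - e₁) - h'(x) = -(h(x) - h(x + e₀))`. [folklore] -/
theorem stepFlux_down_cur (h : Site 2 → ℝ) (x : Site 2) :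
    stepFlux (curH Ω δ h) (curV Ω δ h) x (x - Pi.single 1 1) = -cur Ω δ h x (x + Pi.single 0 1) := by
  rw [stepFlux_down_eq, curH]
  congr 2 <;> rw [one_eq_single_add_single] <;> abel

/-- Corner steps move each coordinate by at most one. [folklore] -/
theorem abs_add_cornerUnit_sub_le (u : Site 2) (k : Fin 4) (i : Fin 2) : |(u + cornerUnit k) i - u i| ≤ 1 := by
  fin_cases k <;> fin_cases i <;> simp [cornerUnit]

/-- Two corner steps move each coordinate by at most two. [folklore] -/
theorem abs_add_cornerUnit_add_sub_le (u : Site 2) (k j : Fin 4) (i : Fin 2) :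
    |(u + cornerUnit k + cornerUnit j) i - u i| ≤ 2 := by
  have h1 := abs_add_cornerUnit_sub_le (u + cornerUnit k) j i
  have h2 := abs_add_cornerUnit_sub_le u k i
  have := abs_sub_le ((u + cornerUnit k + cornerUnit j) i) ((u + cornerUnit k) i) (u i)
  linarith

/-- `|cur x y| ≤ |h x - h y|`. [folklore] -/
theorem abs_cur_le_abs_sub (h : Site 2 → ℝ) (x y : Site 2) : |cur Ω δ h x y| ≤ |h x - h y| := by
  unfold cur; split_ifs <;> simp

open Classical in
/-- **Step bound for the conjugate.** If the squares `x`, `x + cornerUnit k` are inner and the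
increments of `h` along the sides of `x` at `x`, `x + e₀`, `x + e₁` are at most `Bd`, then
`|h'(x + cornerUnit k) - h'(x)| ≤ Bd` (CR when `x` is in the component of the base, both values
`0` otherwise). [folklore] -/
theorem abs_dualPot_step_le (R : RandomPlanarGeometry.ConformalRectangle) (h0 : (0 : ℂ) ∈ R.carrier)
    (hδ : 0 < δ) {h : Site 2 → ℝ} {T B : Set (Site 2)} (hT : T ⊆ boundary R.carrier δ) (hB : B ⊆ boundary R.carrier δ)
    (hharm : ∀ x, x ∉ T → x ∉ B →
      ∑ y ∈ ((zdGraph 2).neighborFinset x).filter (fun y => (domainGraph R.carrier δ).Adj x y), (h y - h x) = 0)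
    {p₀ : Site 2} (hp₀ : IsInnerSq R.carrier δ p₀) {Bd : ℝ} (hBd : 0 ≤ Bd) {x : Site 2} (k : Fin 4)
    (hx : IsInnerSq R.carrier δ x) (hxk : IsInnerSq R.carrier δ (x + cornerUnit k))
    (hstep : ∀ j : Fin 4, |h (x + cornerUnit j) - h x| ≤ Bd ∧ |h (x + Pi.single 0 1 + cornerUnit j) - h (x + Pi.single 0 1)| ≤ Bd ∧
      |h (x + Pi.single 1 1 + cornerUnit j) - h (x + Pi.single 1 1)| ≤ Bd) :
    |dualPot R.carrier δ h p₀ (x + cornerUnit k) - dualPot R.carrier δ h p₀ x| ≤ Bd := by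
  by_cases hr : (dualGraph R.carrier δ).Reachable p₀ x
  · have hadj : (dualGraph R.carrier δ).Adj x (x + cornerUnit k) :=
      dualGraph_adj_iff.2 ⟨adj_of_stepKind (stepKind_add_cornerUnit x k), hx, hxk⟩
    rw [dualPot_sub_dualPot_of_adj R h0 hδ hT hB hharm hp₀ hr hadj]
    fin_cases k
    · -- right: the right side `{x + e₀, x + e₀ + e₁}`
      simp only [cornerUnit]
      rw [stepFlux_right_cur, abs_neg]
      refine (abs_cur_le_abs_sub h _ _).trans ?_
      rw [abs_sub_comm]
      simpa [cornerUnit] using (hstep 1).2.1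
    · -- up: the top side `{x + e₁, x + e₁ + e₀}`
      simp only [cornerUnit]
      rw [stepFlux_up_cur]
      refine (abs_cur_le_abs_sub h _ _).trans ?_
      rw [abs_sub_comm]
      simpa [cornerUnit] using (hstep 0).2.2
    · -- left: the left side `{x, x + e₁}`
      simp only [cornerUnit, ← sub_eq_add_neg]
      rw [stepFlux_left_cur]
      refine (abs_cur_le_abs_sub h _ _).trans ?_
      rw [abs_sub_comm]
      simpa [cornerUnit] using (hstep 1).1
    · -- down: the bottom side `{x, x + e₀}`
      simp only [cornerUnit, ← sub_eq_add_neg]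
      rw [stepFlux_down_cur, abs_neg]
      refine (abs_cur_le_abs_sub h _ _).trans ?_
      rw [abs_sub_comm]
      simpa [cornerUnit] using (hstep 0).1
  · have hr' : ¬ (dualGraph R.carrier δ).Reachable p₀ (x + cornerUnit k) := fun h' =>
      hr (h'.trans (dualGraph_adj_iff.2 ⟨(adj_of_stepKind (stepKind_add_cornerUnit x k)).symm, hxk, hx⟩).reachable)
    rw [dualPot, dif_neg hr', dualPot, dif_neg hr, sub_zero, abs_zero]
    exact hBd

open Classical in
/-- **Local equi-Lipschitz bound for the conjugate in the bulk** (the dual counterpart of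
`exists_forall_abs_sub_le_mul_dist`): if `B̄(z, r) ⊆ Ω`, then for all small meshes, for the
potential `h ∈ [0,1]` harmonic off `T_n ∪ B_n` and its conjugate `h'` based at any inner square,
`|h'(x) - h'(y)| ≤ (64 K / r) · dist` for squares with lower-left mesh points in `B(z, r/32)`.
[cite: GeorgakopoulosPanagiotis2019, Thm 4.3 (via (CRd))] -/
theorem exists_forall_abs_dualPot_sub_le_mul_dist (R : RandomPlanarGeometry.ConformalRectangle)
    (h0 : (0 : ℂ) ∈ R.carrier) {z : ℂ} {r : ℝ} (hr : 0 < r) (hzr : closedBall z r ⊆ R.carrier) :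
    ∃ δ₀ > 0, ∀ δ, 0 < δ → δ < δ₀ → ∀ h : Site 2 → ℝ, (∀ x, h x ∈ Icc (0 : ℝ) 1) →
      (∀ x, x ∉ arcVertices R.carrier δ (R.arc 0) → x ∉ arcVertices R.carrier δ (R.arc 2) →
        ∑ y ∈ ((zdGraph 2).neighborFinset x).filter (fun y => (domainGraph R.carrier δ).Adj x y),
          (h y - h x) = 0) →
      ∀ p₀ : Site 2, IsInnerSq R.carrier δ p₀ →
      ∀ x y : Site 2, meshPoint δ x ∈ ball z (r / 32) → meshPoint δ y ∈ ball z (r / 32) →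
        |dualPot R.carrier δ h p₀ x - dualPot R.carrier δ h p₀ y| ≤
          64 * topGradConst / r * dist (meshPoint δ x) (meshPoint δ y) := by
  have hΩo : IsOpen R.carrier := R.isOpen
  have hΩc : IsConnected R.carrier := R.isConnected
  have hne : R.carrierᶜ.Nonempty := ⟨R.boundary 0, fun h =>
    (R.disjoint_carrier_frontier.ne_of_mem h (R.boundary_mem_frontier 0)) rfl⟩
  obtain ⟨δ₁, hδ₁, hstep⟩ := exists_forall_abs_sub_le hΩo hΩc hne h0 (T := R.arc 0) (B := R.arc 2) hr hzr
  obtain ⟨δ₂, hδ₂, hinner⟩ := exists_forall_isInnerSq hΩo hΩc hne h0 hr hzr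
  have hK := topGradConst_pos
  refine ⟨min (min δ₁ δ₂) (r / 64), by positivity, fun δ hδ hδlt h h01 hharm p₀ hp₀ x y hx hy => ?_⟩
  have hδ₁' : δ < δ₁ := hδlt.trans_le ((min_le_left _ _).trans (min_le_left _ _))
  have hδ₂' : δ < δ₂ := hδlt.trans_le ((min_le_left _ _).trans (min_le_right _ _))
  have hδr : δ < r / 64 := hδlt.trans_le (min_le_right _ _)
  have hT : arcVertices R.carrier δ (R.arc 0) ⊆ boundary R.carrier δ := fun _ hx => hx.1
  have hB : arcVertices R.carrier δ (R.arc 2) ⊆ boundary R.carrier δ := fun _ hx => hx.1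
  -- mesh points near a mesh point of `B(z, r/16)` are in `B(z, r/4)` and `B(z, r/2)`
  have hnear : ∀ x : Site 2, meshPoint δ x ∈ ball z (r / 16) → ∀ v : Site 2,
      (|v 0 - x 0| ≤ 2 ∧ |v 1 - x 1| ≤ 2) → meshPoint δ v ∈ ball z (r / 4) := by
    intro x hx v hv
    have hd : dist (meshPoint δ v) (meshPoint δ x) ≤ 4 * δ := by
      rw [Complex.dist_eq]
      refine (Complex.norm_le_abs_re_add_abs_im _).trans ?_
      simp only [Complex.sub_re, Complex.sub_im, meshPoint_re, meshPoint_im, ← mul_sub, abs_mul, abs_of_pos hδ]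
      rw [abs_le, abs_le] at hv
      have h1 : |((v 0 : ℝ)) - x 0| ≤ 2 := by rw [abs_le]; constructor <;> exact_mod_cast (by omega)
      have h2 : |((v 1 : ℝ)) - x 1| ≤ 2 := by rw [abs_le]; constructor <;> exact_mod_cast (by omega)
      nlinarith [abs_nonneg ((v 0 : ℝ) - x 0), abs_nonneg ((v 1 : ℝ) - x 1)]
    rw [Metric.mem_ball] at hx ⊢
    linarith [dist_triangle (meshPoint δ v) (meshPoint δ x) z]
  have hstep' : ∀ x : Site 2, meshPoint δ x ∈ ball z (r / 16) → ∀ k : Fin 4,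
      |dualPot R.carrier δ h p₀ (x + cornerUnit k) - dualPot R.carrier δ h p₀ x| ≤ 32 * topGradConst * δ / r := by
    intro x hx k
    have hb4 := hnear x hx
    have hin : ∀ v : Site 2, (|v 0 - x 0| ≤ 2 ∧ |v 1 - x 1| ≤ 2) → IsInnerSq R.carrier δ v := fun v hv =>
      hinner δ hδ hδ₂' v (ball_subset_ball (by linarith) (hb4 v hv))
    refine abs_dualPot_step_le R h0 hδ hT hB hharm hp₀ (by positivity) k (hin x ⟨by simp, by simp⟩)
      (hin _ ?_) fun j => ⟨?_, ?_, ?_⟩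
    · exact ⟨(abs_add_cornerUnit_sub_le x k 0).trans (by norm_num), (abs_add_cornerUnit_sub_le x k 1).trans (by norm_num)⟩
    · exact hstep δ hδ hδ₁' h h01 hharm x (hb4 x ⟨by simp, by simp⟩) j
    · exact hstep δ hδ hδ₁' h h01 hharm _ (hb4 _ ⟨by simp, by simp⟩) j
    · exact hstep δ hδ hδ₁' h h01 hharm _ (hb4 _ ⟨by simp, by simp⟩) j
  have hRect : Complex.Rectangle (meshPoint δ x) (meshPoint δ y) ⊆ ball z (r / 16) := by
    have h2 : (2 : ℝ) * (r / 32) = r / 16 := by ring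
    rw [← h2]
    exact rectangle_subset_ball (mem_ball.1 hx) (mem_ball.1 hy)
  have key := abs_sub_le_mul_of_steps hδ hstep' _ x y rfl hRect
  have hℓ := natAbs_add_natAbs_le hδ x y
  calc |dualPot R.carrier δ h p₀ x - dualPot R.carrier δ h p₀ y|
      ≤ 32 * topGradConst * δ / r * (((y 0 - x 0).natAbs + (y 1 - x 1).natAbs : ℕ) : ℝ) := key
    _ = 32 * topGradConst / r * ((((y 0 - x 0).natAbs + (y 1 - x 1).natAbs : ℕ) : ℝ) * δ) := by ring
    _ ≤ 32 * topGradConst / r * (2 * dist (meshPoint δ x) (meshPoint δ y)) := by gcongr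
    _ = 64 * topGradConst / r * dist (meshPoint δ x) (meshPoint δ y) := by ring

end ConjugateBulk

section ConjugateBulk2

open WeakBeurling

variable {δ : ℝ}

/-- The offset of the side of the square `y` crossed by the step in direction `cornerUnit j`,
its direction, and the sign in `h'(y + cornerUnit j) - h'(y) = sgn · (h(a) - h(a + dir))`,
`a = y + off`. [folklore] -/
def crOff (j : Fin 4) : Site 2 := if j = 0 then Pi.single 0 1 else if j = 1 then Pi.single 1 1 else 0

/-- Direction index of the crossed side (see `crOff`). [folklore] -/
def crDir (j : Fin 4) : Fin 4 := if j = 0 ∨ j = 2 then 1 else 0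

/-- Sign of the CR-increment (see `crOff`). [folklore] -/
def crSgn (j : Fin 4) : ℝ := if j = 0 ∨ j = 3 then -1 else 1

open Classical in
/-- **The CR-increments of the conjugate as increments of the potential**: for a square `y` of
the component of the base with `y + cornerUnit j` inner,
`h'(y + cornerUnit j) - h'(y) = crSgn j · (h(a) - h(a + cornerUnit (crDir j)))`, `a = y + crOff j`
(the crossed side is an edge of `Ω_n` because `y` is inner). [cite: GeorgakopoulosPanagiotis2019, §4.1 (CRd)] -/
theorem dualPot_step_eq (R : RandomPlanarGeometry.ConformalRectangle) (h0 : (0 : ℂ) ∈ R.carrier)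
    (hδ : 0 < δ) {h : Site 2 → ℝ} {T B : Set (Site 2)} (hT : T ⊆ boundary R.carrier δ) (hB : B ⊆ boundary R.carrier δ)
    (hharm : ∀ x, x ∉ T → x ∉ B →
      ∑ y ∈ ((zdGraph 2).neighborFinset x).filter (fun y => (domainGraph R.carrier δ).Adj x y), (h y - h x) = 0)
    {p₀ : Site 2} (hp₀ : IsInnerSq R.carrier δ p₀) {y : Site 2} (hy : (dualGraph R.carrier δ).Reachable p₀ y)
    (j : Fin 4) (hyj : IsInnerSq R.carrier δ (y + cornerUnit j)) :
    dualPot R.carrier δ h p₀ (y + cornerUnit j) - dualPot R.carrier δ h p₀ y =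
      crSgn j * (h (y + crOff j) - h (y + crOff j + cornerUnit (crDir j))) := by
  have hyI : IsInnerSq R.carrier δ y := by
    obtain ⟨W⟩ := hy; exact isInnerSq_of_mem_support' hp₀ W (Walk.end_mem_support _)
  have hadj : (dualGraph R.carrier δ).Adj y (y + cornerUnit j) :=
    dualGraph_adj_iff.2 ⟨adj_of_stepKind (stepKind_add_cornerUnit y j), hyI, hyj⟩
  rw [dualPot_sub_dualPot_of_adj R h0 hδ hT hB hharm hp₀ hy hadj]
  obtain ⟨aB, aT, aL, aR⟩ := hyI
  fin_cases j
  · simp only [cornerUnit, crSgn, crOff, crDir, Fin.zero_eta, Fin.isValue, ↓reduceIte, true_or]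
    rw [stepFlux_right_cur, cur_of_adj aR]; ring
  · simp only [cornerUnit, crSgn, crOff, crDir, Fin.mk_one, Fin.isValue, one_ne_zero, ↓reduceIte, false_or,
      show ¬ ((1 : Fin 4) = 2) by decide, show ¬ ((1 : Fin 4) = 3) by decide]
    rw [stepFlux_up_cur, cur_of_adj aT]; ring
  · simp only [cornerUnit, crSgn, crOff, crDir, Fin.reduceFinMk, Fin.isValue, ↓reduceIte, or_true,
      show ¬ ((2 : Fin 4) = 0) by decide, show ¬ ((2 : Fin 4) = 1) by decide, show ¬ ((2 : Fin 4) = 3) by decide,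
      false_or, ← sub_eq_add_neg, add_zero]
    rw [stepFlux_left_cur, cur_of_adj aL]; ring
  · simp only [cornerUnit, crSgn, crOff, crDir, Fin.reduceFinMk, Fin.isValue, ↓reduceIte, or_true,
      show ¬ ((3 : Fin 4) = 0) by decide, show ¬ ((3 : Fin 4) = 1) by decide, show ¬ ((3 : Fin 4) = 2) by decide,
      false_or, ← sub_eq_add_neg, add_zero]
    rw [stepFlux_down_cur, cur_of_adj aB]; ring

/-- The offsets `crOff j` are within one step. [folklore] -/
theorem crOff_apply_le (j : Fin 4) : |crOff j 0| ≤ 1 ∧ |crOff j 1| ≤ 1 ∧ 0 ≤ crOff j 0 ∧ 0 ≤ crOff j 1 := by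
  unfold crOff
  fin_cases j <;> simp

open Classical in
/-- **Second differences of the conjugate in the bulk**: if `B̄(z, r) ⊆ Ω`, then for all small
meshes, for the potential `h ∈ [0,1]` harmonic off `T_n ∪ B_n` and its conjugate `h'` based at
any inner square, the mixed second differences of `h'` at squares with lower-left mesh point in
`B(z, r/32)` are at most `4096 K² δ² / r²` (they are second differences of `h`, by (CRd)).
[cite: GeorgakopoulosPanagiotis2019, §4.1] -/
theorem exists_forall_abs_dualPot_second_diff_le (R : RandomPlanarGeometry.ConformalRectangle)
    (h0 : (0 : ℂ) ∈ R.carrier) {z : ℂ} {r : ℝ} (hr : 0 < r) (hzr : closedBall z r ⊆ R.carrier) :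
    ∃ δ₀ > 0, ∀ δ, 0 < δ → δ < δ₀ → ∀ h : Site 2 → ℝ, (∀ x, h x ∈ Icc (0 : ℝ) 1) →
      (∀ x, x ∉ arcVertices R.carrier δ (R.arc 0) → x ∉ arcVertices R.carrier δ (R.arc 2) →
        ∑ y ∈ ((zdGraph 2).neighborFinset x).filter (fun y => (domainGraph R.carrier δ).Adj x y),
          (h y - h x) = 0) →
      ∀ p₀ : Site 2, IsInnerSq R.carrier δ p₀ →
      ∀ x : Site 2, meshPoint δ x ∈ ball z (r / 32) → ∀ j k : Fin 4,
        |(dualPot R.carrier δ h p₀ (x + cornerUnit k + cornerUnit j) - dualPot R.carrier δ h p₀ (x + cornerUnit k)) -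
          (dualPot R.carrier δ h p₀ (x + cornerUnit j) - dualPot R.carrier δ h p₀ x)| ≤
          4096 * topGradConst ^ 2 * δ ^ 2 / r ^ 2 := by
  have hΩo : IsOpen R.carrier := R.isOpen
  have hΩc : IsConnected R.carrier := R.isConnected
  have hne : R.carrierᶜ.Nonempty := ⟨R.boundary 0, fun h =>
    (R.disjoint_carrier_frontier.ne_of_mem h (R.boundary_mem_frontier 0)) rfl⟩
  obtain ⟨δ₁, hδ₁, hsec⟩ := exists_forall_abs_second_diff_le hΩo hΩc hne h0 (T := R.arc 0) (B := R.arc 2) hr hzr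
  obtain ⟨δ₂, hδ₂, hinner⟩ := exists_forall_isInnerSq hΩo hΩc hne h0 hr hzr
  have hK := topGradConst_pos
  refine ⟨min (min δ₁ δ₂) (r / 256), by positivity, fun δ hδ hδlt h h01 hharm p₀ hp₀ x hx j k => ?_⟩
  have hδ₁' : δ < δ₁ := hδlt.trans_le ((min_le_left _ _).trans (min_le_left _ _))
  have hδ₂' : δ < δ₂ := hδlt.trans_le ((min_le_left _ _).trans (min_le_right _ _))
  have hδr : δ < r / 256 := hδlt.trans_le (min_le_right _ _)
  have hT : arcVertices R.carrier δ (R.arc 0) ⊆ boundary R.carrier δ := fun _ hx => hx.1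
  have hB : arcVertices R.carrier δ (R.arc 2) ⊆ boundary R.carrier δ := fun _ hx => hx.1
  -- lattice points within three steps of `x` have mesh points in `B(z, r/16)`
  have hnear : ∀ v : Site 2, (|v 0 - x 0| ≤ 3 ∧ |v 1 - x 1| ≤ 3) → meshPoint δ v ∈ ball z (r / 16) := by
    intro v hv
    have hd : dist (meshPoint δ v) (meshPoint δ x) ≤ 6 * δ := by
      rw [Complex.dist_eq]
      refine (Complex.norm_le_abs_re_add_abs_im _).trans ?_
      simp only [Complex.sub_re, Complex.sub_im, meshPoint_re, meshPoint_im, ← mul_sub, abs_mul, abs_of_pos hδ]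
      rw [abs_le, abs_le] at hv
      have h1 : |((v 0 : ℝ)) - x 0| ≤ 3 := by rw [abs_le]; constructor <;> exact_mod_cast (by omega)
      have h2 : |((v 1 : ℝ)) - x 1| ≤ 3 := by rw [abs_le]; constructor <;> exact_mod_cast (by omega)
      nlinarith [abs_nonneg ((v 0 : ℝ) - x 0), abs_nonneg ((v 1 : ℝ) - x 1)]
    rw [Metric.mem_ball] at hx ⊢
    linarith [dist_triangle (meshPoint δ v) (meshPoint δ x) z]
  have hin : ∀ v : Site 2, (|v 0 - x 0| ≤ 3 ∧ |v 1 - x 1| ≤ 3) → IsInnerSq R.carrier δ v := fun v hv =>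
    hinner δ hδ hδ₂' v (ball_subset_ball (by linarith) (hnear v hv))
  -- inner squares involved
  have hxI : IsInnerSq R.carrier δ x := hin x ⟨by simp, by simp⟩
  have hxkI : IsInnerSq R.carrier δ (x + cornerUnit k) :=
    hin _ ⟨(abs_add_cornerUnit_sub_le x k 0).trans (by norm_num), (abs_add_cornerUnit_sub_le x k 1).trans (by norm_num)⟩
  have hxjI : IsInnerSq R.carrier δ (x + cornerUnit j) :=
    hin _ ⟨(abs_add_cornerUnit_sub_le x j 0).trans (by norm_num), (abs_add_cornerUnit_sub_le x j 1).trans (by norm_num)⟩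
  have hxkjI : IsInnerSq R.carrier δ (x + cornerUnit k + cornerUnit j) :=
    hin _ ⟨(abs_add_cornerUnit_add_sub_le x k j 0).trans (by norm_num), (abs_add_cornerUnit_add_sub_le x k j 1).trans (by norm_num)⟩
  by_cases hrx : (dualGraph R.carrier δ).Reachable p₀ x
  · have hrxk : (dualGraph R.carrier δ).Reachable p₀ (x + cornerUnit k) :=
      hrx.trans (dualGraph_adj_iff.2 ⟨adj_of_stepKind (stepKind_add_cornerUnit x k), hxI, hxkI⟩).reachable
    rw [dualPot_step_eq R h0 hδ hT hB hharm hp₀ hrxk j hxkjI, dualPot_step_eq R h0 hδ hT hB hharm hp₀ hrx j hxjI,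
      ← mul_sub, abs_mul]
    have hsgn : |crSgn j| = 1 := by unfold crSgn; split_ifs <;> simp
    rw [hsgn, one_mul]
    -- a second difference of `h` at `a = x + crOff j`
    have hoff := crOff_apply_le j
    have ha : meshPoint δ (x + crOff j) ∈ ball z (r / 16) := by
      refine hnear _ ⟨?_, ?_⟩ <;> simp <;> [exact hoff.1.trans (by norm_num); exact hoff.2.1.trans (by norm_num)]
    have key := hsec δ hδ hδ₁' h h01 hharm (x + crOff j) ha (crDir j) k
    rw [show x + cornerUnit k + crOff j = x + crOff j + cornerUnit k by abel]
    have e : (h (x + crOff j + cornerUnit k) - h (x + crOff j + cornerUnit k + cornerUnit (crDir j))) -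
        (h (x + crOff j) - h (x + crOff j + cornerUnit (crDir j))) =
        -((h (x + crOff j + cornerUnit k + cornerUnit (crDir j)) - h (x + crOff j + cornerUnit k)) -
          (h (x + crOff j + cornerUnit (crDir j)) - h (x + crOff j))) := by ring
    rw [e, abs_neg]
    exact key
  · -- off the component all four values vanish
    have hr1 : ¬ (dualGraph R.carrier δ).Reachable p₀ (x + cornerUnit k) := fun h' =>
      hrx (h'.trans (dualGraph_adj_iff.2 ⟨(adj_of_stepKind (stepKind_add_cornerUnit x k)).symm, hxkI, hxI⟩).reachable)
    have hr2 : ¬ (dualGraph R.carrier δ).Reachable p₀ (x + cornerUnit j) := fun h' =>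
      hrx (h'.trans (dualGraph_adj_iff.2 ⟨(adj_of_stepKind (stepKind_add_cornerUnit x j)).symm, hxjI, hxI⟩).reachable)
    have hr3 : ¬ (dualGraph R.carrier δ).Reachable p₀ (x + cornerUnit k + cornerUnit j) := fun h' =>
      hr1 (h'.trans (dualGraph_adj_iff.2 ⟨(adj_of_stepKind (stepKind_add_cornerUnit _ j)).symm, hxkjI, hxkI⟩).reachable)
    simp only [dualPot, dif_neg hrx, dif_neg hr1, dif_neg hr2, dif_neg hr3, sub_self, abs_zero]
    positivity

end ConjugateBulk2

/-! ### §L3. Local bounds for the conjugate based at a fixed point -/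

section LocalBound

open WeakBeurling

variable {δ : ℝ}

open Classical in
/-- The conjugate vanishes at its base square. [folklore] -/
theorem dualPot_base (R : RandomPlanarGeometry.ConformalRectangle) (h0 : (0 : ℂ) ∈ R.carrier) (hδ : 0 < δ)
    {h : Site 2 → ℝ} {T B : Set (Site 2)} (hT : T ⊆ boundary R.carrier δ) (hB : B ⊆ boundary R.carrier δ)
    (hharm : ∀ x, x ∉ T → x ∉ B →
      ∑ y ∈ ((zdGraph 2).neighborFinset x).filter (fun y => (domainGraph R.carrier δ).Adj x y), (h y - h x) = 0)
    {p₀ : Site 2} (hp₀ : IsInnerSq R.carrier δ p₀) : dualPot R.carrier δ h p₀ p₀ = 0 := by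
  rw [dualPot_eq_walkFlux R h0 hδ hT hB hharm hp₀ (Walk.nil : (dualGraph R.carrier δ).Walk p₀ p₀)]
  simp [walkFlux_nil]

/-- The base square `(⌊xs/δ⌋, ⌊ys/δ⌋)` has its mesh point within `2δ` of `xs + ys i`. [folklore] -/
theorem dist_meshPoint_floorBase_le (hδ : 0 < δ) (xs ys : ℝ) :
    dist (meshPoint δ ![⌊xs / δ⌋, ⌊ys / δ⌋]) ⟨xs, ys⟩ ≤ 2 * δ := by
  have h1 := Int.floor_le (xs / δ); have h1' := Int.lt_floor_add_one (xs / δ)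
  have h2 := Int.floor_le (ys / δ); have h2' := Int.lt_floor_add_one (ys / δ)
  rw [le_div_iff₀ hδ] at h1 h2
  rw [div_lt_iff₀ hδ] at h1' h2'
  rw [Complex.dist_eq]
  refine (Complex.norm_le_abs_re_add_abs_im _).trans ?_
  simp only [Complex.sub_re, Complex.sub_im, meshPoint_re, meshPoint_im, Matrix.cons_val_zero, Matrix.cons_val_one,
    Matrix.cons_val_fin_one]
  have ha : |δ * (⌊xs / δ⌋ : ℝ) - xs| ≤ δ := abs_le.2 ⟨by nlinarith, by nlinarith⟩
  have hb : |δ * (⌊ys / δ⌋ : ℝ) - ys| ≤ δ := abs_le.2 ⟨by nlinarith, by nlinarith⟩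
  linarith

open Classical in
/-- **Local boundedness of the conjugates.** For `Ω` containing the point `c⋆ = xs + ys i` and
`z ∈ Ω`, there are `s > 0`, `M` and `δ₀ > 0` such that for every mesh `δ < δ₀` and every
potential `h` (with values in `[0,1]`, harmonic off `T_n ∪ B_n`), the base square of `c⋆` is
inner and the conjugate based there is bounded by `M` at all squares with mesh point in
`B(z, s)` — by chaining the local Lipschitz bound `exists_forall_abs_dualPot_sub_le_mul_dist`
along a path from `c⋆` to `z`. [folklore] -/
theorem exists_local_bound_dualPot (R : RandomPlanarGeometry.ConformalRectangle) (h0 : (0 : ℂ) ∈ R.carrier)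
    {xs ys : ℝ} (hc : (⟨xs, ys⟩ : ℂ) ∈ R.carrier) {z : ℂ} (hz : z ∈ R.carrier) :
    ∃ s > 0, ∃ M : ℝ, ∃ δ₀ > 0, ∀ δ, 0 < δ → δ < δ₀ → ∀ h : Site 2 → ℝ, (∀ x, h x ∈ Icc (0 : ℝ) 1) →
      (∀ x, x ∉ arcVertices R.carrier δ (R.arc 0) → x ∉ arcVertices R.carrier δ (R.arc 2) →
        ∑ y ∈ ((zdGraph 2).neighborFinset x).filter (fun y => (domainGraph R.carrier δ).Adj x y),
          (h y - h x) = 0) →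
      IsInnerSq R.carrier δ ![⌊xs / δ⌋, ⌊ys / δ⌋] ∧
      ∀ x : Site 2, meshPoint δ x ∈ ball z s → |dualPot R.carrier δ h ![⌊xs / δ⌋, ⌊ys / δ⌋] x| ≤ M := by
  have hΩo : IsOpen R.carrier := R.isOpen
  have hΩc : IsConnected R.carrier := R.isConnected
  have hne : R.carrierᶜ.Nonempty := ⟨R.boundary 0, fun h =>
    (R.disjoint_carrier_frontier.ne_of_mem h (R.boundary_mem_frontier 0)) rfl⟩
  -- a path from `c⋆` to `z` in `Ω`, and a tube about it
  have hpc : IsPathConnected R.carrier := (hΩo.isConnected_iff_isPathConnected).1 hΩc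
  obtain ⟨γ, hγ⟩ := (hpc.joinedIn _ hc _ hz)
  set Γ : ℝ → ℂ := fun t => γ.extend t with hΓ
  have hΓc : Continuous Γ := γ.continuous_extend
  have hΓmem : ∀ t ∈ Icc (0 : ℝ) 1, Γ t ∈ R.carrier := fun t ht => by
    show γ.extend t ∈ R.carrier
    rw [show (t : ℝ) = ((⟨t, ht⟩ : Icc (0 : ℝ) 1) : ℝ) from rfl, Path.extend_extends' γ ⟨t, ht⟩]; exact hγ _
  have hKc : IsCompact (Γ '' Icc 0 1) := isCompact_Icc.image hΓc
  have hKΩ : Γ '' Icc 0 1 ⊆ R.carrier := by rintro _ ⟨t, ht, rfl⟩; exact hΓmem t ht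
  obtain ⟨ρ, hρ, hρΩ⟩ := hKc.exists_cthickening_subset_open hΩo hKΩ
  have hballΩ : ∀ t ∈ Icc (0 : ℝ) 1, closedBall (Γ t) ρ ⊆ R.carrier := fun t ht w hw =>
    hρΩ (Metric.mem_cthickening_of_dist_le w (Γ t) ρ _ (mem_image_of_mem Γ ht) (mem_closedBall.1 hw))
  -- uniform continuity: a partition `tᵢ = i/N` with consecutive points within `ρ/128`
  obtain ⟨τ, hτ, hτu⟩ := Metric.uniformContinuousOn_iff.1 (isCompact_Icc.uniformContinuousOn_of_continuous hΓc.continuousOn)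
    (ρ / 128) (by positivity)
  obtain ⟨N, hN⟩ := exists_nat_gt (1 / τ)
  have hNpos : 0 < N := by
    have : (0 : ℝ) < N := lt_trans (by positivity) hN
    exact_mod_cast this
  have hNr : (0 : ℝ) < N := by exact_mod_cast hNpos
  set t : ℕ → ℝ := fun i => (i : ℝ) / N with ht
  have htmem : ∀ i ≤ N, t i ∈ Icc (0 : ℝ) 1 := fun i hi =>
    ⟨by positivity, by rw [ht]; exact div_le_one_of_le₀ (by exact_mod_cast hi) hNr.le⟩
  have htclose : ∀ i < N, dist (Γ (t (i + 1))) (Γ (t i)) < ρ / 128 := by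
    intro i hi
    refine hτu _ (htmem _ hi) _ (htmem _ hi.le) ?_
    rw [ht, Real.dist_eq]; push_cast
    rw [show ((i : ℝ) + 1) / N - i / N = 1 / N by field_simp; ring, abs_of_pos (by positivity)]
    rw [div_lt_iff₀ hNr]; rw [div_lt_iff₀ hτ] at hN; linarith
  -- the Lipschitz bounds on the balls `B(Γ tᵢ, ρ/32)`
  have hLip := fun i : Fin (N + 1) =>
    exists_forall_abs_dualPot_sub_le_mul_dist R h0 hρ (hballΩ (t i) (htmem i (Nat.lt_succ_iff.1 i.2)))
  choose δL hδL hL using hLip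
  -- the base square is inner for small meshes
  obtain ⟨δb, hδb, hinner⟩ := exists_forall_isInnerSq hΩo hΩc hne h0 hρ (hballΩ 0 ⟨le_rfl, zero_le_one⟩)
  set δ₀ : ℝ := min (min (Finset.univ.inf' Finset.univ_nonempty δL) δb) (ρ / 128) with hδ₀
  have hδ₀pos : 0 < δ₀ := by
    rw [hδ₀]; refine lt_min (lt_min ((Finset.lt_inf'_iff _).2 fun i _ => hδL i) hδb) (by positivity)
  have hK := topGradConst_pos
  set L : ℝ := 64 * topGradConst / ρ with hLdef
  have hL0 : 0 ≤ L := by positivity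
  refine ⟨ρ / 64, by positivity, L * ρ * (N + 2), δ₀, hδ₀pos, fun δ hδ hδlt h h01 hharm => ?_⟩
  have hδL' : ∀ i, δ < δL i := fun i =>
    hδlt.trans_le ((min_le_left _ _).trans ((min_le_left _ _).trans (Finset.inf'_le _ (Finset.mem_univ i))))
  have hδb' : δ < δb := hδlt.trans_le ((min_le_left _ _).trans (min_le_right _ _))
  have hδρ : δ < ρ / 128 := hδlt.trans_le (min_le_right _ _)
  have hΓ0 : Γ (t 0) = ⟨xs, ys⟩ := by simp [ht, hΓ]
  have hΓ1 : Γ (t N) = z := by rw [ht]; simp [hNr.ne', hΓ]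
  -- the base square
  set p₀ : Site 2 := ![⌊xs / δ⌋, ⌊ys / δ⌋] with hp₀
  have hp₀near : dist (meshPoint δ p₀) (Γ (t 0)) ≤ 2 * δ := by rw [hΓ0]; exact dist_meshPoint_floorBase_le hδ xs ys
  have hp₀inner : IsInnerSq R.carrier δ p₀ := by
    refine hinner δ hδ hδb' p₀ ?_
    rw [Metric.mem_ball]
    have : Γ 0 = Γ (t 0) := by simp [ht]
    rw [this]; linarith
  refine ⟨hp₀inner, fun x hx => ?_⟩
  -- the chain of lattice points
  set y : ℕ → Site 2 := fun i => nearestSite δ (Γ (t i)) with hy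
  have hynear : ∀ i, dist (meshPoint δ (y i)) (Γ (t i)) ≤ δ := fun i => dist_meshPoint_nearestSite_le hδ _
  have hTsub : arcVertices R.carrier δ (R.arc 0) ⊆ boundary R.carrier δ := fun _ hx => hx.1
  have hBsub : arcVertices R.carrier δ (R.arc 2) ⊆ boundary R.carrier δ := fun _ hx => hx.1
  -- Lipschitz on ball `i`
  have hLi : ∀ i ≤ N, ∀ a b : Site 2, meshPoint δ a ∈ ball (Γ (t i)) (ρ / 32) → meshPoint δ b ∈ ball (Γ (t i)) (ρ / 32) →
      |dualPot R.carrier δ h p₀ a - dualPot R.carrier δ h p₀ b| ≤ L * dist (meshPoint δ a) (meshPoint δ b) := by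
    intro i hi a b ha hb
    have := hL ⟨i, Nat.lt_succ_iff.2 hi⟩ δ hδ (hδL' _) h h01 hharm p₀ hp₀inner a b ha hb
    simpa [hLdef] using this
  -- step `i → i+1`
  have hstep : ∀ i < N, |dualPot R.carrier δ h p₀ (y (i + 1)) - dualPot R.carrier δ h p₀ (y i)| ≤ L * ρ := by
    intro i hi
    have ha : meshPoint δ (y (i + 1)) ∈ ball (Γ (t i)) (ρ / 32) := by
      rw [Metric.mem_ball]
      linarith [dist_triangle (meshPoint δ (y (i + 1))) (Γ (t (i + 1))) (Γ (t i)), hynear (i + 1), htclose i hi]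
    have hb : meshPoint δ (y i) ∈ ball (Γ (t i)) (ρ / 32) := by
      rw [Metric.mem_ball]; linarith [hynear i]
    refine (hLi i hi.le _ _ ha hb).trans (mul_le_mul_of_nonneg_left ?_ hL0)
    rw [Metric.mem_ball] at ha hb
    linarith [dist_triangle (meshPoint δ (y (i + 1))) (Γ (t i)) (meshPoint δ (y i)), dist_comm (Γ (t i)) (meshPoint δ (y i))]
  have hchain : ∀ i ≤ N, |dualPot R.carrier δ h p₀ (y i) - dualPot R.carrier δ h p₀ (y 0)| ≤ L * ρ * i := by
    intro i hi
    induction i with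
    | zero => simp
    | succ i ih =>
      have h1 := ih (Nat.le_of_succ_le hi)
      have h2 := hstep i hi
      have := abs_sub_le (dualPot R.carrier δ h p₀ (y (i + 1))) (dualPot R.carrier δ h p₀ (y i)) (dualPot R.carrier δ h p₀ (y 0))
      push_cast
      linarith
  -- the ends
  have hstart : |dualPot R.carrier δ h p₀ (y 0) - dualPot R.carrier δ h p₀ p₀| ≤ L * ρ := by
    have ha : meshPoint δ (y 0) ∈ ball (Γ (t 0)) (ρ / 32) := by rw [Metric.mem_ball]; linarith [hynear 0]
    have hb : meshPoint δ p₀ ∈ ball (Γ (t 0)) (ρ / 32) := by rw [Metric.mem_ball]; linarith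
    refine (hLi 0 (Nat.zero_le _) _ _ ha hb).trans (mul_le_mul_of_nonneg_left ?_ hL0)
    rw [Metric.mem_ball] at ha hb
    linarith [dist_triangle (meshPoint δ (y 0)) (Γ (t 0)) (meshPoint δ p₀), dist_comm (Γ (t 0)) (meshPoint δ p₀)]
  have hend : |dualPot R.carrier δ h p₀ x - dualPot R.carrier δ h p₀ (y N)| ≤ L * ρ := by
    have hx' : meshPoint δ x ∈ ball (Γ (t N)) (ρ / 32) := by
      rw [hΓ1]; rw [Metric.mem_ball] at hx ⊢; linarith
    have hb : meshPoint δ (y N) ∈ ball (Γ (t N)) (ρ / 32) := by rw [Metric.mem_ball]; linarith [hynear N]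
    refine (hLi N le_rfl _ _ hx' hb).trans (mul_le_mul_of_nonneg_left ?_ hL0)
    rw [Metric.mem_ball] at hx' hb
    linarith [dist_triangle (meshPoint δ x) (Γ (t N)) (meshPoint δ (y N)), dist_comm (Γ (t N)) (meshPoint δ (y N))]
  have hbase : dualPot R.carrier δ h p₀ p₀ = 0 := dualPot_base R h0 hδ hTsub hBsub hharm hp₀inner
  have h3 := hchain N le_rfl
  have h4 := abs_sub_le (dualPot R.carrier δ h p₀ x) (dualPot R.carrier δ h p₀ (y N)) (dualPot R.carrier δ h p₀ (y 0))
  have h5 := abs_sub_le (dualPot R.carrier δ h p₀ x) (dualPot R.carrier δ h p₀ (y 0)) (dualPot R.carrier δ h p₀ p₀)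
  simp only [hbase, sub_zero] at h5 hstart
  have hρL : 0 ≤ L * ρ := by positivity
  have e : L * ρ * ((N : ℝ) + 2) = L * ρ * N + L * ρ + L * ρ := by ring
  rw [e]
  linarith

end LocalBound

/-! ### §L4a. Small analytic lemmas: lattice shifts, the conjugate pair as a holomorphic function -/

section Analytic

/-- Shifting by one mesh step to the right shifts the nearest site by `e₀`. [folklore] -/
theorem nearestSite_add_right {δ : ℝ} (hδ : δ ≠ 0) (w : ℂ) :
    nearestSite δ (w + δ) = nearestSite δ w + Pi.single 0 1 := by
  ext i; fin_cases i
  · simp [nearestSite, add_div, div_self hδ, round_add_one]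
  · simp [nearestSite]

/-- Shifting by one mesh step upwards shifts the nearest site by `e₁`. [folklore] -/
theorem nearestSite_add_up {δ : ℝ} (hδ : δ ≠ 0) (w : ℂ) :
    nearestSite δ (w + δ * Complex.I) = nearestSite δ w + Pi.single 1 1 := by
  ext i; fin_cases i
  · simp [nearestSite]
  · simp [nearestSite, add_div, div_self hδ, round_add_one]

/-- The real-linear functional `ζ ↦ g₀ Re ζ + g₁ Im ζ` has operator norm `‖g₀ + g₁ i‖`. [folklore] -/
theorem norm_smul_reCLM_add_smul_imCLM (g₀ g₁ : ℝ) :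
    ‖g₀ • Complex.reCLM + g₁ • Complex.imCLM‖ = ‖(⟨g₀, g₁⟩ : ℂ)‖ := by
  set c : ℂ := ⟨g₀, g₁⟩ with hc
  have happly : ∀ ζ : ℂ, (g₀ • Complex.reCLM + g₁ • Complex.imCLM) ζ = ((starRingEnd ℂ c) * ζ).re := by
    intro ζ; simp [hc]
  apply le_antisymm
  · refine ContinuousLinearMap.opNorm_le_bound _ (norm_nonneg _) fun ζ => ?_
    rw [happly, Real.norm_eq_abs]
    calc |((starRingEnd ℂ c) * ζ).re| ≤ ‖(starRingEnd ℂ c) * ζ‖ := Complex.abs_re_le_norm _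
      _ = ‖c‖ * ‖ζ‖ := by rw [norm_mul, Complex.norm_conj]
  · by_cases h0 : c = 0
    · rw [h0, norm_zero]; exact norm_nonneg _
    · have hcn : 0 < ‖c‖ := norm_pos_iff.2 h0
      have := (g₀ • Complex.reCLM + g₁ • Complex.imCLM).le_opNorm c
      rw [happly, Real.norm_eq_abs, Complex.conj_mul', ← Complex.ofReal_pow, Complex.ofReal_re, abs_of_nonneg (by positivity),
        sq] at this
      exact le_of_mul_le_mul_right this hcn

/-- **A `C¹` conjugate pair is holomorphic.** If `u`, `v` have real Fréchet derivatives
`ζ ↦ g₁ Re ζ - g₀ Im ζ` and `ζ ↦ g₀ Re ζ + g₁ Im ζ` at `w` (the Cauchy–Riemann equations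
`uₓ = v_y`, `u_y = -vₓ`), then `f = u + i v` has the complex derivative `g₁ + i g₀` at `w`.
[folklore] -/
theorem hasDerivAt_of_cr {u v : ℂ → ℝ} {g₀ g₁ : ℝ} {w : ℂ}
    (hu : HasFDerivAt u (g₁ • Complex.reCLM + (-g₀) • Complex.imCLM) w)
    (hv : HasFDerivAt v (g₀ • Complex.reCLM + g₁ • Complex.imCLM) w) :
    HasDerivAt (fun z => ((u z : ℂ) + (v z : ℂ) * Complex.I)) ((g₁ : ℂ) + (g₀ : ℂ) * Complex.I) w := by
  have hu' : HasFDerivAt (fun z => (u z : ℂ)) (Complex.ofRealCLM.comp (g₁ • Complex.reCLM + (-g₀) • Complex.imCLM)) w :=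
    Complex.ofRealCLM.hasFDerivAt.comp w hu
  have hv' : HasFDerivAt (fun z => (v z : ℂ)) (Complex.ofRealCLM.comp (g₀ • Complex.reCLM + g₁ • Complex.imCLM)) w :=
    Complex.ofRealCLM.hasFDerivAt.comp w hv
  have hf := hu'.add (hv'.mul_const Complex.I)
  rw [hasDerivAt_iff_hasFDerivAt]
  refine hasFDerivAt_of_restrictScalars (𝕜 := ℝ) hf ?_
  ext ζ
  simp only [ContinuousLinearMap.coe_restrictScalars', ContinuousLinearMap.toSpanSingleton_apply]
  apply Complex.ext <;> simp <;> ring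

end Analytic

/-! ### §L4b. Squares near a point are eventually in the component of the base -/

section Reach

open WeakBeurling

variable {δ : ℝ}

/-- **Squares near a point of `Ω` are inner and in the component of the base square of `c⋆`,
for all small meshes.** [folklore] -/
theorem exists_forall_reachable_near (R : RandomPlanarGeometry.ConformalRectangle) (h0 : (0 : ℂ) ∈ R.carrier)
    {xs ys : ℝ} (hc : (⟨xs, ys⟩ : ℂ) ∈ R.carrier) {z : ℂ} (hz : z ∈ R.carrier) :
    ∃ s > 0, ∃ δ₀ > 0, ∀ δ, 0 < δ → δ < δ₀ →
      IsInnerSq R.carrier δ ![⌊xs / δ⌋, ⌊ys / δ⌋] ∧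
      ∀ x : Site 2, meshPoint δ x ∈ ball z s →
        IsInnerSq R.carrier δ x ∧ (dualGraph R.carrier δ).Reachable ![⌊xs / δ⌋, ⌊ys / δ⌋] x := by
  have hΩo : IsOpen R.carrier := R.isOpen
  have hΩc : IsConnected R.carrier := R.isConnected
  have hne : R.carrierᶜ.Nonempty := ⟨R.boundary 0, fun h =>
    (R.disjoint_carrier_frontier.ne_of_mem h (R.boundary_mem_frontier 0)) rfl⟩
  have hpc : IsPathConnected R.carrier := (hΩo.isConnected_iff_isPathConnected).1 hΩc
  obtain ⟨γ, hγ⟩ := (hpc.joinedIn _ hc _ hz)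
  set Γ : ℝ → ℂ := fun t => γ.extend t with hΓ
  have hΓc : Continuous Γ := γ.continuous_extend
  have hΓmem : ∀ t ∈ Icc (0 : ℝ) 1, Γ t ∈ R.carrier := fun t ht => by
    show γ.extend t ∈ R.carrier
    rw [show (t : ℝ) = ((⟨t, ht⟩ : Icc (0 : ℝ) 1) : ℝ) from rfl, Path.extend_extends' γ ⟨t, ht⟩]; exact hγ _
  set K := Γ '' Icc 0 1 with hK
  have hKc : IsCompact K := isCompact_Icc.image hΓc
  have hKΩ : K ⊆ R.carrier := by rintro _ ⟨t, ht, rfl⟩; exact hΓmem t ht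
  obtain ⟨ρ, hρ, hρΩ⟩ := hKc.exists_cthickening_subset_open hΩo hKΩ
  set K' := Metric.cthickening (ρ / 2) K with hK'
  have hK'c : IsCompact K' := hKc.cthickening
  have hK'Ω : K' ⊆ R.carrier := (Metric.cthickening_mono (by linarith) K).trans hρΩ
  obtain ⟨δ₁, hδ₁, hinn⟩ := exists_forall_isInnerSq_of_near hΩo hΩc hne h0 hK'c hK'Ω
  have hΓ0 : Γ 0 = ⟨xs, ys⟩ := by simp [hΓ]
  have hΓ1 : Γ 1 = z := by simp [hΓ]
  have hzK : z ∈ K := ⟨1, ⟨zero_le_one, le_rfl⟩, hΓ1⟩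
  refine ⟨ρ / 4, by positivity, min δ₁ (ρ / 16), by positivity, fun δ hδ hδlt => ?_⟩
  have hδ₁' : δ < δ₁ := hδlt.trans_le (min_le_left _ _)
  have hδρ : δ < ρ / 16 := hδlt.trans_le (min_le_right _ _)
  have hinn' : ∀ q : Site 2, (∃ w ∈ K', w ∈ closedSq δ q) → IsInnerSq R.carrier δ q := hinn δ hδ hδ₁'
  have hnearK : ∀ {w : ℂ}, (∃ y ∈ K, dist w y ≤ ρ / 2) → w ∈ K' := fun ⟨y, hy, hwy⟩ =>
    Metric.mem_cthickening_of_dist_le _ y _ _ hy hwy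
  -- the shadow of the path
  obtain ⟨ω₁, -, hω₁s⟩ := exists_dualWalk_of_path hδ zero_le_one hΓc.continuousOn
    (P := floorSq δ ⟨xs, ys⟩) (P' := floorSq δ z) (by rw [hΓ0]; exact mem_closedSq_floorSq hδ _) (by rw [hΓ1]; exact mem_closedSq_floorSq hδ _)
  have hp₀eq : (![⌊xs / δ⌋, ⌊ys / δ⌋] : Site 2) = floorSq δ ⟨xs, ys⟩ := (floorSq_mk δ xs ys).symm
  have hω₁inner : ∀ q ∈ ω₁.support, IsInnerSq R.carrier δ q := fun q hq => by
    obtain ⟨w, hw, hwq⟩ := near_of_shadow hω₁s hq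
    exact hinn' q ⟨w, hnearK ⟨w, hw, by rw [_root_.dist_self]; positivity⟩, hwq⟩
  refine ⟨by rw [hp₀eq]; exact hω₁inner _ (Walk.start_mem_support _), fun x hx => ?_⟩
  -- the shadow of the segment from `z` to the mesh point of `x`
  obtain ⟨hLc, hL0, hL1, hLim⟩ := lineMap_props z (meshPoint δ x)
  obtain ⟨ω₂, -, hω₂s⟩ := exists_dualWalk_of_path hδ zero_le_one hLc (P := floorSq δ z) (P' := x)
    (by show AffineMap.lineMap _ _ (0 : ℝ) ∈ _; rw [hL0]; exact mem_closedSq_floorSq hδ _)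
    (by show AffineMap.lineMap _ _ (1 : ℝ) ∈ _; rw [hL1]; exact meshPoint_mem_closedSq hδ.le (Or.inl rfl) (Or.inl rfl))
  have hω₂inner : ∀ q ∈ ω₂.support, IsInnerSq R.carrier δ q := fun q hq => by
    obtain ⟨w, hw, hwq⟩ := near_of_shadow hω₂s hq
    rw [hLim] at hw
    refine hinn' q ⟨w, hnearK ⟨z, hzK, ?_⟩, hwq⟩
    have h1 : dist w z ≤ dist (meshPoint δ x) z := by
      have := (convex_closedBall z (dist (meshPoint δ x) z)).segment_subset (mem_closedBall_self dist_nonneg)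
        (mem_closedBall.2 le_rfl) hw
      exact mem_closedBall.1 this
    rw [Metric.mem_ball] at hx
    linarith
  have hall : ∀ q ∈ (ω₁.append ω₂).support, IsInnerSq R.carrier δ q := fun q hq => by
    rw [Walk.mem_support_append_iff] at hq
    exact hq.elim (hω₁inner q) (hω₂inner q)
  refine ⟨hω₂inner x (Walk.end_mem_support _), ?_⟩
  rw [hp₀eq]
  exact reachable_of_mem_support_inner (ω₁.append ω₂) hall (Walk.start_mem_support _) (Walk.end_mem_support _)

end Reach

/-! ### §L4c. The holomorphic limit `f = u + i v` of the conjugate pairs along a subsequence -/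

section HoloLimit

open WeakBeurling MeasureTheory

open Classical in
/-- **Joint subsequential limits of the potentials and their conjugates form a holomorphic
function of finite Dirichlet energy.** Along any subsequence `k` of the dyadic meshes with
`𝒞(T_{k n} ↔ B_{k n}) → I`, after passing to a further subsequence `φ`: the potentials
`h_{k φ n}` converge locally uniformly to `v`, their conjugates based at the square of
`c⋆ = xs + ys i` converge locally uniformly to `u`, `f = u + i v` is holomorphic on `Ω` with
`∫∫_Ω ‖f'‖² ≤ I` ([GP19] §4.1: (CRd) in the limit gives the Cauchy–Riemann equations; Fatou as
in Theorem 4.6). [cite: GeorgakopoulosPanagiotis2019, §4.1 and Theorem 4.6] -/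
theorem exists_holomorphic_limit (R : RandomPlanarGeometry.ConformalRectangle)
    (h0 : (0 : ℂ) ∈ R.carrier) (hsep : ∀ n : ℕ, OppositeArcsSeparated R ((2 : ℝ)⁻¹ ^ n))
    {k : ℕ → ℕ} (hk : StrictMono k) {I : ℝ≥0∞}
    (hI : Tendsto (fun n => effectiveConductance (domainGraph R.carrier ((2 : ℝ)⁻¹ ^ k n)) 1
      (arcVertices R.carrier ((2 : ℝ)⁻¹ ^ k n) (R.arc 0))
      (arcVertices R.carrier ((2 : ℝ)⁻¹ ^ k n) (R.arc 2))) atTop (𝓝 I))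
    {xs ys : ℝ} (hc : (⟨xs, ys⟩ : ℂ) ∈ R.carrier) :
    ∃ h : ℕ → Site 2 → ℝ,
      (∀ n, (arcVertices R.carrier ((2 : ℝ)⁻¹ ^ k n) (R.arc 0)).EqOn (h n) 1 ∧
        (arcVertices R.carrier ((2 : ℝ)⁻¹ ^ k n) (R.arc 2)).EqOn (h n) 0 ∧
        (∀ x, h n x ∈ Icc (0 : ℝ) 1) ∧
        networkEnergy (domainGraph R.carrier ((2 : ℝ)⁻¹ ^ k n)) 1 (h n) =
          effectiveConductance (domainGraph R.carrier ((2 : ℝ)⁻¹ ^ k n)) 1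
            (arcVertices R.carrier ((2 : ℝ)⁻¹ ^ k n) (R.arc 0)) (arcVertices R.carrier ((2 : ℝ)⁻¹ ^ k n) (R.arc 2)) ∧
        ∀ x, x ∉ arcVertices R.carrier ((2 : ℝ)⁻¹ ^ k n) (R.arc 0) → x ∉ arcVertices R.carrier ((2 : ℝ)⁻¹ ^ k n) (R.arc 2) →
          ∑ y ∈ ((zdGraph 2).neighborFinset x).filter (fun y => (domainGraph R.carrier ((2 : ℝ)⁻¹ ^ k n)).Adj x y),
            (h n y - h n x) = 0) ∧
      ∃ φ : ℕ → ℕ, StrictMono φ ∧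
      ∃ f : ℂ → ℂ, DifferentiableOn ℂ f R.carrier ∧
        (∫⁻ w in R.carrier, ‖deriv f w‖ₑ ^ 2) ≤ I ∧
        ∀ z ∈ R.carrier, ∃ s > 0, TendstoUniformlyOn
          (fun n w => dualPot R.carrier ((2 : ℝ)⁻¹ ^ k (φ n)) (h (φ n))
            ![⌊xs / (2 : ℝ)⁻¹ ^ k (φ n)⌋, ⌊ys / (2 : ℝ)⁻¹ ^ k (φ n)⌋]
            (nearestSite ((2 : ℝ)⁻¹ ^ k (φ n)) w))
          (fun w => (f w).re) atTop (ball z s) := by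
  classical
  have hΩo : IsOpen R.carrier := R.isOpen
  have hΩc : IsConnected R.carrier := R.isConnected
  have hne : R.carrierᶜ.Nonempty := ⟨R.boundary 0, fun h =>
    (R.disjoint_carrier_frontier.ne_of_mem h (R.boundary_mem_frontier 0)) rfl⟩
  have hδ : ∀ n, (0 : ℝ) < (2 : ℝ)⁻¹ ^ k n := fun n => by positivity
  have hδ0 : Tendsto (fun n => ((2 : ℝ)⁻¹) ^ k n) atTop (𝓝 0) :=
    (tendsto_pow_atTop_nhds_zero_of_lt_one (by norm_num) (by norm_num)).comp hk.tendsto_atTop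
  -- the potentials `h_n`
  choose h hT hB h01 hE hharm using fun n => exists_potential R (hδ n) (hsep (k n))
  refine ⟨h, fun n => ⟨hT n, hB n, h01 n, hE n, hharm n⟩, ?_⟩
  have hTsub : ∀ n, arcVertices R.carrier ((2 : ℝ)⁻¹ ^ k n) (R.arc 0) ⊆ boundary R.carrier ((2 : ℝ)⁻¹ ^ k n) :=
    fun n x hx => hx.1
  have hBsub : ∀ n, arcVertices R.carrier ((2 : ℝ)⁻¹ ^ k n) (R.arc 2) ⊆ boundary R.carrier ((2 : ℝ)⁻¹ ^ k n) :=
    fun n x hx => hx.1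
  -- equi-Lipschitz bound in the bulk (Thm 4.3)
  have hL : ∀ z ∈ R.carrier, ∃ r > 0, ∃ L ≥ (0 : ℝ), ∀ᶠ n in atTop, ∀ x y : Site 2,
      meshPoint ((2 : ℝ)⁻¹ ^ k n) x ∈ ball z r → meshPoint ((2 : ℝ)⁻¹ ^ k n) y ∈ ball z r →
        |h n x - h n y| ≤
          L * dist (meshPoint ((2 : ℝ)⁻¹ ^ k n) x) (meshPoint ((2 : ℝ)⁻¹ ^ k n) y) := by
    intro z hz
    obtain ⟨r₀, hr₀, hzr₀⟩ := Metric.nhds_basis_closedBall.mem_iff.1 (hΩo.mem_nhds hz)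
    obtain ⟨δ₀, hδ₀, H⟩ :=
      exists_forall_abs_sub_le_mul_dist hΩo hΩc hne h0 (T := R.arc 0) (B := R.arc 2) hr₀ hzr₀
    have hK := topGradConst_pos
    refine ⟨r₀ / 16, by positivity, 64 * topGradConst / r₀, by positivity, ?_⟩
    filter_upwards [(tendsto_order.1 hδ0).2 _ hδ₀] with n hn x y hx hy
    exact H _ (hδ n) hn (h n) (h01 n) (hharm n) x y hx hy
  -- first extraction: the potentials
  obtain ⟨φ₁, hφ₁, -, v, -, hvloc₁⟩ := exists_subseq_tendstoLocallyUniformly hΩo hδ hδ0 h01 hL (fun _ => (0 : ℝ≥0∞))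
  have hδ₁ : ∀ n, (0 : ℝ) < (2 : ℝ)⁻¹ ^ k (φ₁ n) := fun n => hδ (φ₁ n)
  have hδ₁0 : Tendsto (fun n => ((2 : ℝ)⁻¹) ^ k (φ₁ n)) atTop (𝓝 0) := hδ0.comp hφ₁.tendsto_atTop
  -- the conjugates along `φ₁`, squashed into `[0,1]`
  set p₀ : ℕ → Site 2 := fun n => ![⌊xs / (2 : ℝ)⁻¹ ^ k n⌋, ⌊ys / (2 : ℝ)⁻¹ ^ k n⌋] with hp₀
  set Hc : ℕ → Site 2 → ℝ := fun n x => dualPot R.carrier ((2 : ℝ)⁻¹ ^ k n) (h n) (p₀ n) x with hHc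
  have hp₀inner : ∀ z ∈ R.carrier, ∀ᶠ n in atTop, IsInnerSq R.carrier ((2 : ℝ)⁻¹ ^ k n) (p₀ n) := by
    intro z hz
    obtain ⟨s₀, -, δ₀, hδ₀, Hr⟩ := exists_forall_reachable_near R h0 hc hz
    filter_upwards [(tendsto_order.1 hδ0).2 _ hδ₀] with n hn
    exact (Hr _ (hδ n) hn).1
  have hL' : ∀ z ∈ R.carrier, ∃ r > 0, ∃ L ≥ (0 : ℝ), ∀ᶠ n in atTop, ∀ x y : Site 2,
      meshPoint ((2 : ℝ)⁻¹ ^ k (φ₁ n)) x ∈ ball z r → meshPoint ((2 : ℝ)⁻¹ ^ k (φ₁ n)) y ∈ ball z r →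
        |sqz (Hc (φ₁ n) x) - sqz (Hc (φ₁ n) y)| ≤
          L * dist (meshPoint ((2 : ℝ)⁻¹ ^ k (φ₁ n)) x) (meshPoint ((2 : ℝ)⁻¹ ^ k (φ₁ n)) y) := by
    intro z hz
    obtain ⟨r₀, hr₀, hzr₀⟩ := Metric.nhds_basis_closedBall.mem_iff.1 (hΩo.mem_nhds hz)
    obtain ⟨δ₀, hδ₀, H⟩ := exists_forall_abs_dualPot_sub_le_mul_dist R h0 hr₀ hzr₀
    have hK := topGradConst_pos
    refine ⟨r₀ / 32, by positivity, 64 * topGradConst / r₀, by positivity, ?_⟩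
    filter_upwards [(tendsto_order.1 hδ₁0).2 _ hδ₀, (hp₀inner z hz).filter_mono (hφ₁.tendsto_atTop)]
      with n hn hp x y hx hy
    exact (abs_sqz_sub_sqz_le _ _).trans (H _ (hδ₁ n) hn (h (φ₁ n)) (h01 (φ₁ n)) (hharm (φ₁ n)) (p₀ (φ₁ n)) hp x y hx hy)
  -- second extraction: the squashed conjugates
  obtain ⟨φ₂, hφ₂, -, ut, -, hutloc⟩ := exists_subseq_tendstoLocallyUniformly hΩo hδ₁ hδ₁0
    (h := fun n x => sqz (Hc (φ₁ n) x)) (fun n x => sqz_mem_Icc _) hL' (fun _ => (0 : ℝ≥0∞))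
  set φ : ℕ → ℕ := φ₁ ∘ φ₂ with hφdef
  have hφ : StrictMono φ := hφ₁.comp hφ₂
  refine ⟨φ, hφ, ?_⟩
  have hI' : Tendsto (fun n => effectiveConductance (domainGraph R.carrier ((2 : ℝ)⁻¹ ^ k (φ n))) 1
      (arcVertices R.carrier ((2 : ℝ)⁻¹ ^ k (φ n)) (R.arc 0))
      (arcVertices R.carrier ((2 : ℝ)⁻¹ ^ k (φ n)) (R.arc 2))) atTop (𝓝 I) := hI.comp hφ.tendsto_atTop
  have hδ' : ∀ n, (0 : ℝ) < (2 : ℝ)⁻¹ ^ k (φ n) := fun n => hδ (φ n)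
  have hδ'0 : Tendsto (fun n => ((2 : ℝ)⁻¹) ^ k (φ n)) atTop (𝓝 0) := hδ0.comp hφ.tendsto_atTop
  have hvloc : ∀ z ∈ R.carrier, ∃ r > 0,
      (∃ L ≥ (0 : ℝ), ∀ w ∈ ball z r, ∀ w' ∈ ball z r, |v w - v w'| ≤ L * dist w w') ∧
      TendstoUniformlyOn (fun n w => h (φ n) (nearestSite ((2 : ℝ)⁻¹ ^ k (φ n)) w)) v atTop (ball z r) := by
    intro z hz
    obtain ⟨r, hr, hLip, hconv⟩ := hvloc₁ z hz
    exact ⟨r, hr, hLip, fun u hu => hφ₂.tendsto_atTop.eventually (hconv u hu)⟩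
  -- ### the potential side (as in `inv_extremalDistance_le_of_subseq`)
  have hloc : ∀ z ∈ R.carrier, ∃ s > 0, ∃ g₀ g₁ : ℂ → ℝ, ContinuousOn g₀ (ball z s) ∧
      ContinuousOn g₁ (ball z s) ∧
      TendstoUniformlyOn
        (fun n w => (h (φ n) (nearestSite ((2 : ℝ)⁻¹ ^ k (φ n)) w + Pi.single 0 1) -
          h (φ n) (nearestSite ((2 : ℝ)⁻¹ ^ k (φ n)) w)) / (2 : ℝ)⁻¹ ^ k (φ n)) g₀ atTop (ball z s) ∧
      TendstoUniformlyOn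
        (fun n w => (h (φ n) (nearestSite ((2 : ℝ)⁻¹ ^ k (φ n)) w + Pi.single 1 1) -
          h (φ n) (nearestSite ((2 : ℝ)⁻¹ ^ k (φ n)) w)) / (2 : ℝ)⁻¹ ^ k (φ n)) g₁ atTop (ball z s) ∧
      ∀ w ∈ ball z s, HasFDerivAt v (g₀ w • Complex.reCLM + g₁ w • Complex.imCLM) w :=
    fun z hz => exists_local_hasFDerivAt hΩo hΩc hne h0 (T := R.arc 0) (B := R.arc 2)
      (δ' := fun n => (2 : ℝ)⁻¹ ^ k (φ n)) hδ' hδ'0 (H := fun n => h (φ n)) (fun n => h01 (φ n))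
      (fun n => hharm (φ n)) hvloc hz
  choose s hs g₀ g₁ hg₀c hg₁c hg₀u hg₁u hF using hloc
  have hfd : ∀ z (hz : z ∈ R.carrier), ∀ w ∈ ball z (s z hz),
      fderiv ℝ v w = g₀ z hz w • Complex.reCLM + g₁ z hz w • Complex.imCLM :=
    fun z hz w hw => (hF z hz w hw).fderiv
  have hvc : ContinuousOn (fderiv ℝ v) R.carrier := by
    intro z hz
    have hcont : ContinuousOn (fun w => g₀ z hz w • Complex.reCLM + g₁ z hz w • Complex.imCLM)
        (ball z (s z hz)) :=
      ((hg₀c z hz).smul continuousOn_const).add ((hg₁c z hz).smul continuousOn_const)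
    exact ((hcont.congr fun w hw => hfd z hz w hw).continuousAt
      (ball_mem_nhds z (hs z hz))).continuousWithinAt
  have hDi : ∀ i : Fin 2, ∀ z (hz : z ∈ R.carrier), TendstoUniformlyOn
      (fun n w => (h (φ n) (nearestSite ((2 : ℝ)⁻¹ ^ k (φ n)) w + Pi.single i 1) -
        h (φ n) (nearestSite ((2 : ℝ)⁻¹ ^ k (φ n)) w)) / (2 : ℝ)⁻¹ ^ k (φ n))
      (fun w => fderiv ℝ v w (if i = 0 then (1 : ℂ) else Complex.I)) atTop (ball z (s z hz)) := by
    refine Fin.forall_fin_two.2 ⟨fun z hz => ?_, fun z hz => ?_⟩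
    · refine (hg₀u z hz).congr_right fun w hw => ?_
      simp only [Fin.isValue, ↓reduceIte]
      rw [hfd z hz w hw]
      simp
    · refine (hg₁u z hz).congr_right fun w hw => ?_
      simp only [Fin.isValue, one_ne_zero, ↓reduceIte]
      rw [hfd z hz w hw]
      simp
  have hD : ∀ i : Fin 2, TendstoLocallyUniformlyOn
      (fun n w => (h (φ n) (nearestSite ((2 : ℝ)⁻¹ ^ k (φ n)) w + Pi.single i 1) -
        h (φ n) (nearestSite ((2 : ℝ)⁻¹ ^ k (φ n)) w)) / (2 : ℝ)⁻¹ ^ k (φ n))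
      (fun w => fderiv ℝ v w (if i = 0 then (1 : ℂ) else Complex.I)) atTop R.carrier :=
    fun i u hu z hz => ⟨ball z (s z hz), mem_nhdsWithin_of_mem_nhds (ball_mem_nhds z (hs z hz)),
      hDi i z hz u hu⟩
  have hedges : ∀ K' ⊆ R.carrier, IsCompact K' → ∀ᶠ n in atTop, ∀ x : Site 2,
      meshPoint ((2 : ℝ)⁻¹ ^ k (φ n)) x ∈ K' → ∀ i : Fin 2,
        s(x, x + (Pi.single i 1 : Site 2)) ∈ (domainGraph R.carrier ((2 : ℝ)⁻¹ ^ k (φ n))).edgeSet :=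
    fun K' hK' hK'c => eventually_axisEdges_mem hΩo hΩc hne h0 hδ' hδ'0 hK' hK'c
  have hC : ∀ n, networkEnergy (domainGraph R.carrier ((2 : ℝ)⁻¹ ^ k (φ n))) 1 (h (φ n)) ≤
      effectiveConductance (domainGraph R.carrier ((2 : ℝ)⁻¹ ^ k (φ n))) 1
        (arcVertices R.carrier ((2 : ℝ)⁻¹ ^ k (φ n)) (R.arc 0))
        (arcVertices R.carrier ((2 : ℝ)⁻¹ ^ k (φ n)) (R.arc 2)) := fun n => (hE (φ n)).le
  have hint : ∫⁻ w in R.carrier, ‖fderiv ℝ v w‖ₑ ^ 2 ≤ I :=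
    lintegral_norm_fderiv_sq_le hΩo R.isBounded (k := fun n => k (φ n))
      ((hk.comp hφ).tendsto_atTop) (h := fun n => h (φ n)) hedges hC hI' hvc hD
  -- ### the conjugate side: the limit `u`
  set u : ℂ → ℝ := fun w => unsqz (ut w) with hu
  have hU : ∀ z ∈ R.carrier, ∃ s' > 0,
      TendstoUniformlyOn (fun n w => Hc (φ n) (nearestSite ((2 : ℝ)⁻¹ ^ k (φ n)) w)) u atTop (ball z s') ∧
      ContinuousOn u (ball z s') := by
    intro z hz
    obtain ⟨r, hr, ⟨Lu, hLu0, hLu⟩, hconv⟩ := hutloc z hz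
    obtain ⟨s₁, hs₁, M, δ₀, hδ₀, Hb⟩ := exists_local_bound_dualPot R h0 hc hz
    set s' := min r (s₁ / 2) with hs'
    have hs'pos : 0 < s' := by positivity
    -- eventually the squashed conjugates take values in `[sqz (-M), sqz M]` on the ball
    have hrange : ∀ᶠ n in atTop, ∀ w ∈ ball z s', |Hc (φ n) (nearestSite ((2 : ℝ)⁻¹ ^ k (φ n)) w)| ≤ M := by
      filter_upwards [(tendsto_order.1 hδ'0).2 _ (lt_min hδ₀ (half_pos hs₁))] with n hn w hw
      have hn₀ : (2 : ℝ)⁻¹ ^ k (φ n) < δ₀ := hn.trans_le (min_le_left _ _)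
      have hn₁ : (2 : ℝ)⁻¹ ^ k (φ n) < s₁ / 2 := hn.trans_le (min_le_right _ _)
      refine (Hb _ (hδ' n) hn₀ (h (φ n)) (h01 (φ n)) (hharm (φ n))).2 _ ?_
      rw [Metric.mem_ball] at hw ⊢
      have := dist_meshPoint_nearestSite_le (hδ' n) w
      linarith [dist_triangle (meshPoint ((2 : ℝ)⁻¹ ^ k (φ n)) (nearestSite ((2 : ℝ)⁻¹ ^ k (φ n)) w)) w z, min_le_right r (s₁ / 2)]
    have hsqzrange : ∀ᶠ n in atTop, ∀ w ∈ ball z s',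
        sqz (Hc (φ n) (nearestSite ((2 : ℝ)⁻¹ ^ k (φ n)) w)) ∈ Icc (sqz (-M)) (sqz M) := by
      filter_upwards [hrange] with n hn w hw
      have := abs_le.1 (hn w hw)
      exact ⟨sqz_strictMono.monotone this.1, sqz_strictMono.monotone this.2⟩
    have hutrange : ∀ w ∈ ball z s', ut w ∈ Icc (sqz (-M)) (sqz M) := fun w hw =>
      isClosed_Icc.mem_of_tendsto (hconv.tendsto_at (ball_subset_ball (min_le_left _ _) hw))
        (hsqzrange.mono fun n hn => hn w hw)
    have hIoo : Icc (sqz (-M)) (sqz M) ⊆ Ioo 0 1 := fun y hy =>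
      ⟨(sqz_mem_Ioo _).1.trans_le hy.1, hy.2.trans_lt (sqz_mem_Ioo _).2⟩
    refine ⟨s', hs'pos, ?_, ?_⟩
    · rw [Metric.tendstoUniformlyOn_iff]
      intro ε hε
      obtain ⟨η, hη, hηu⟩ := Metric.uniformContinuousOn_iff.1 (uniformContinuousOn_unsqz (sqz_mem_Ioo (-M)).1 (sqz_mem_Ioo M).2) ε hε
      filter_upwards [(Metric.tendstoUniformlyOn_iff.1 hconv) η hη, hsqzrange] with n hn hn' w hw
      have h1 := hn w (ball_subset_ball (min_le_left _ _) hw)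
      have := hηu _ (hutrange w hw) _ (hn' w hw) h1
      rwa [unsqz_sqz] at this
    · have hutc : ContinuousOn ut (ball z s') := by
        refine Metric.continuousOn_iff.2 fun w hw ε hε => ⟨ε / (Lu + 1), by positivity, fun w' hw' hd => ?_⟩
        have := hLu w' (ball_subset_ball (min_le_left _ _) hw') w (ball_subset_ball (min_le_left _ _) hw)
        rw [Real.dist_eq]
        calc |ut w' - ut w| ≤ Lu * dist w' w := this
          _ < Lu * (ε / (Lu + 1)) + 1 * (ε / (Lu + 1)) := by nlinarith [dist_nonneg (x := w') (y := w)]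
          _ = ε := by field_simp
      exact continuousOn_unsqz.comp hutc fun w hw => hIoo (hutrange w hw)
  -- ### `u` is `C¹` with `∇u = (v_y, -v_x)`
  have hK := topGradConst_pos
  have hCR : ∀ z (hz : z ∈ R.carrier), ∃ ρ > 0, ρ ≤ s z hz ∧ ∀ w ∈ ball z ρ,
      HasFDerivAt u (g₁ z hz w • Complex.reCLM + (-(g₀ z hz w)) • Complex.imCLM) w := by
    intro z hz
    obtain ⟨r₀, hr₀, hzr₀⟩ := Metric.nhds_basis_closedBall.mem_iff.1 (hΩo.mem_nhds hz)
    obtain ⟨δL, hδL, HLip⟩ := exists_forall_abs_dualPot_sub_le_mul_dist R h0 hr₀ hzr₀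
    obtain ⟨δ2, hδ2, H2⟩ := exists_forall_abs_dualPot_second_diff_le R h0 hr₀ hzr₀
    obtain ⟨sr, hsr, δr, hδr, Hr⟩ := exists_forall_reachable_near R h0 hc hz
    obtain ⟨su, hsu, hconv, hcont⟩ := hU z hz
    set r' := min (r₀ / 64) (min su sr) with hr'
    have hr'pos : 0 < r' := by positivity
    have hr'r₀ : r' ≤ r₀ / 64 := min_le_left _ _
    have hr'su : r' ≤ su := (min_le_right _ _).trans (min_le_left _ _)
    have hr'sr : r' ≤ sr := (min_le_right _ _).trans (min_le_right _ _)
    -- the inputs of `exists_partialDeriv_limit`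
    have hsmall : ∀ᶠ n in atTop, (2 : ℝ)⁻¹ ^ k (φ n) < min (min δL δ2) (min δr (r₀ / 64)) :=
      (tendsto_order.1 hδ'0).2 _ (by positivity)
    have h1 : ∀ᶠ n in atTop, ∀ x : Site 2, meshPoint ((2 : ℝ)⁻¹ ^ k (φ n)) x ∈ ball z r' → ∀ kk : Fin 4,
        |Hc (φ n) (x + cornerUnit kk) - Hc (φ n) x| ≤ 64 * topGradConst / r₀ * (2 : ℝ)⁻¹ ^ k (φ n) := by
      filter_upwards [hsmall] with n hn x hx kk
      have hnL : (2 : ℝ)⁻¹ ^ k (φ n) < δL := hn.trans_le ((min_le_left _ _).trans (min_le_left _ _))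
      have hnr : (2 : ℝ)⁻¹ ^ k (φ n) < δr := hn.trans_le ((min_le_right _ _).trans (min_le_left _ _))
      have hn64 : (2 : ℝ)⁻¹ ^ k (φ n) < r₀ / 64 := hn.trans_le ((min_le_right _ _).trans (min_le_right _ _))
      have hp := (Hr _ (hδ' n) hnr).1
      have hadj : (zdGraph 2).Adj x (x + cornerUnit kk) := adj_of_stepKind (stepKind_add_cornerUnit x kk)
      have hd : dist (meshPoint ((2 : ℝ)⁻¹ ^ k (φ n)) (x + cornerUnit kk)) (meshPoint ((2 : ℝ)⁻¹ ^ k (φ n)) x) =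
          (2 : ℝ)⁻¹ ^ k (φ n) := by rw [_root_.dist_comm]; exact dist_meshPoint_adj (hδ' n).le hadj
      have hx32 : meshPoint ((2 : ℝ)⁻¹ ^ k (φ n)) x ∈ ball z (r₀ / 32) := ball_subset_ball (by linarith) hx
      have hxk32 : meshPoint ((2 : ℝ)⁻¹ ^ k (φ n)) (x + cornerUnit kk) ∈ ball z (r₀ / 32) := by
        rw [Metric.mem_ball] at hx ⊢
        linarith [dist_triangle (meshPoint ((2 : ℝ)⁻¹ ^ k (φ n)) (x + cornerUnit kk)) (meshPoint ((2 : ℝ)⁻¹ ^ k (φ n)) x) z]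
      have := HLip _ (hδ' n) hnL (h (φ n)) (h01 (φ n)) (hharm (φ n)) (p₀ (φ n)) hp _ _ hxk32 hx32
      rwa [hd] at this
    have h2 : ∀ᶠ n in atTop, ∀ x : Site 2, meshPoint ((2 : ℝ)⁻¹ ^ k (φ n)) x ∈ ball z r' → ∀ j kk : Fin 4,
        |(Hc (φ n) (x + cornerUnit kk + cornerUnit j) - Hc (φ n) (x + cornerUnit kk)) -
          (Hc (φ n) (x + cornerUnit j) - Hc (φ n) x)| ≤ 4096 * topGradConst ^ 2 / r₀ ^ 2 * ((2 : ℝ)⁻¹ ^ k (φ n)) ^ 2 := by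
      filter_upwards [hsmall] with n hn x hx j kk
      have hn2 : (2 : ℝ)⁻¹ ^ k (φ n) < δ2 := hn.trans_le ((min_le_left _ _).trans (min_le_right _ _))
      have hnr : (2 : ℝ)⁻¹ ^ k (φ n) < δr := hn.trans_le ((min_le_right _ _).trans (min_le_left _ _))
      have hp := (Hr _ (hδ' n) hnr).1
      have hx32 : meshPoint ((2 : ℝ)⁻¹ ^ k (φ n)) x ∈ ball z (r₀ / 32) := ball_subset_ball (by linarith) hx
      have := H2 _ (hδ' n) hn2 (h (φ n)) (h01 (φ n)) (hharm (φ n)) (p₀ (φ n)) hp x hx32 j kk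
      calc _ ≤ 4096 * topGradConst ^ 2 * ((2 : ℝ)⁻¹ ^ k (φ n)) ^ 2 / r₀ ^ 2 := this
        _ = _ := by ring
    have hL₁ : (0 : ℝ) ≤ 64 * topGradConst / r₀ := by positivity
    have hL₂ : (0 : ℝ) ≤ 4096 * topGradConst ^ 2 / r₀ ^ 2 := by positivity
    obtain ⟨gu₀, hgu₀c, hgu₀u, hq₀⟩ := exists_partialDeriv_limit (z := z) hr'pos hL₁ hL₂ hδ' hδ'0
      (H := fun n => Hc (φ n)) (hconv.mono (ball_subset_ball hr'su)) (hcont.mono (ball_subset_ball hr'su)) h1 h2 0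
    obtain ⟨gu₁, hgu₁c, hgu₁u, hq₁⟩ := exists_partialDeriv_limit (z := z) hr'pos hL₁ hL₂ hδ' hδ'0
      (H := fun n => Hc (φ n)) (hconv.mono (ball_subset_ball hr'su)) (hcont.mono (ball_subset_ball hr'su)) h1 h2 1
    simp only [Fin.isValue, ↓reduceIte, mul_one] at hq₀
    simp only [Fin.isValue, one_ne_zero, ↓reduceIte] at hq₁
    have hFu : ∀ w ∈ ball z (r' / 8), HasFDerivAt u (gu₀ w • Complex.reCLM + gu₁ w • Complex.imCLM) w := fun w hw =>
      hasFDerivAt_of_quotient_bounds hr'pos (by positivity) hgu₀c hgu₁c (fun w hw s hs hs' => by simpa using hq₀ w hw s hs hs') hq₁ hw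
    -- identification of the partial derivatives via (CRd)
    set ρ := min (r' / 8) (s z hz / 2) with hρ
    have hρpos : 0 < ρ := lt_min (by positivity) (half_pos (hs z hz))
    refine ⟨ρ, hρpos, (min_le_right _ _).trans (half_le_self (hs z hz).le), fun w hw => ?_⟩
    have hw8 : w ∈ ball z (r' / 8) := ball_subset_ball (min_le_left _ _) hw
    have hw4 : w ∈ ball z (r' / 4) := ball_subset_ball (by linarith [min_le_left (r' / 8) (s z hz / 2)]) hw
    have hws : w ∈ ball z (s z hz / 2) := ball_subset_ball (min_le_right _ _) hw
    -- limits of the `u`-quotients at `w`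
    have hlim₀ := hgu₀u.tendsto_at hw4
    have hlim₁ := hgu₁u.tendsto_at hw4
    -- the same quotients as shifted `v`-quotients
    have hD1 : Tendsto (fun n => (h (φ n) (nearestSite ((2 : ℝ)⁻¹ ^ k (φ n)) (w + Complex.ofReal ((2 : ℝ)⁻¹ ^ k (φ n))) + Pi.single 1 1) -
          h (φ n) (nearestSite ((2 : ℝ)⁻¹ ^ k (φ n)) (w + Complex.ofReal ((2 : ℝ)⁻¹ ^ k (φ n))))) / (2 : ℝ)⁻¹ ^ k (φ n)) atTop (𝓝 (g₁ z hz w)) := by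
      have hsz := hs z hz
      refine (hg₁u z hz).tendsto_comp ((hg₁c z hz).continuousWithinAt ?_) ?_
      · exact ball_subset_ball (by linarith) hws
      · refine tendsto_nhdsWithin_iff.2 ⟨?_, ?_⟩
        · have : Tendsto (fun n => w + Complex.ofReal ((2 : ℝ)⁻¹ ^ k (φ n))) atTop (𝓝 (w + Complex.ofReal 0)) :=
            tendsto_const_nhds.add (Complex.continuous_ofReal.continuousAt.tendsto.comp hδ'0)
          simpa using this
        · filter_upwards [(tendsto_order.1 hδ'0).2 _ (half_pos hsz)] with n hn
          rw [Metric.mem_ball] at hws ⊢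
          have e : dist (w + Complex.ofReal ((2 : ℝ)⁻¹ ^ k (φ n))) w = (2 : ℝ)⁻¹ ^ k (φ n) := by
            rw [dist_eq_norm, add_sub_cancel_left, Complex.norm_real, Real.norm_of_nonneg (hδ' n).le]
          linarith [dist_triangle (w + Complex.ofReal ((2 : ℝ)⁻¹ ^ k (φ n))) w z]
    have hD0 : Tendsto (fun n => (h (φ n) (nearestSite ((2 : ℝ)⁻¹ ^ k (φ n)) (w + Complex.ofReal ((2 : ℝ)⁻¹ ^ k (φ n)) * Complex.I) + Pi.single 0 1) -
          h (φ n) (nearestSite ((2 : ℝ)⁻¹ ^ k (φ n)) (w + Complex.ofReal ((2 : ℝ)⁻¹ ^ k (φ n)) * Complex.I))) / (2 : ℝ)⁻¹ ^ k (φ n)) atTop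
          (𝓝 (g₀ z hz w)) := by
      have hsz := hs z hz
      refine (hg₀u z hz).tendsto_comp ((hg₀c z hz).continuousWithinAt ?_) ?_
      · exact ball_subset_ball (by linarith) hws
      · refine tendsto_nhdsWithin_iff.2 ⟨?_, ?_⟩
        · have : Tendsto (fun n => w + Complex.ofReal ((2 : ℝ)⁻¹ ^ k (φ n)) * Complex.I) atTop (𝓝 (w + Complex.ofReal 0 * Complex.I)) :=
            tendsto_const_nhds.add ((Complex.continuous_ofReal.continuousAt.tendsto.comp hδ'0).mul_const _)
          simpa using this
        · filter_upwards [(tendsto_order.1 hδ'0).2 _ (half_pos hsz)] with n hn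
          rw [Metric.mem_ball] at hws ⊢
          have e : dist (w + Complex.ofReal ((2 : ℝ)⁻¹ ^ k (φ n)) * Complex.I) w = (2 : ℝ)⁻¹ ^ k (φ n) := by
            rw [dist_eq_norm, add_sub_cancel_left, norm_mul, Complex.norm_I, mul_one, Complex.norm_real, Real.norm_of_nonneg (hδ' n).le]
          linarith [dist_triangle (w + Complex.ofReal ((2 : ℝ)⁻¹ ^ k (φ n)) * Complex.I) w z]
    -- (CRd) at the nearest site of `w`, eventually
    have hCRd : ∀ᶠ n in atTop,
        (Hc (φ n) (nearestSite ((2 : ℝ)⁻¹ ^ k (φ n)) w + Pi.single 0 1) - Hc (φ n) (nearestSite ((2 : ℝ)⁻¹ ^ k (φ n)) w)) / (2 : ℝ)⁻¹ ^ k (φ n) =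
          (h (φ n) (nearestSite ((2 : ℝ)⁻¹ ^ k (φ n)) (w + Complex.ofReal ((2 : ℝ)⁻¹ ^ k (φ n))) + Pi.single 1 1) -
            h (φ n) (nearestSite ((2 : ℝ)⁻¹ ^ k (φ n)) (w + Complex.ofReal ((2 : ℝ)⁻¹ ^ k (φ n))))) / (2 : ℝ)⁻¹ ^ k (φ n) ∧
        (Hc (φ n) (nearestSite ((2 : ℝ)⁻¹ ^ k (φ n)) w + Pi.single 1 1) - Hc (φ n) (nearestSite ((2 : ℝ)⁻¹ ^ k (φ n)) w)) / (2 : ℝ)⁻¹ ^ k (φ n) =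
          -((h (φ n) (nearestSite ((2 : ℝ)⁻¹ ^ k (φ n)) (w + Complex.ofReal ((2 : ℝ)⁻¹ ^ k (φ n)) * Complex.I) + Pi.single 0 1) -
            h (φ n) (nearestSite ((2 : ℝ)⁻¹ ^ k (φ n)) (w + Complex.ofReal ((2 : ℝ)⁻¹ ^ k (φ n)) * Complex.I))) / (2 : ℝ)⁻¹ ^ k (φ n)) := by
      filter_upwards [(tendsto_order.1 hδ'0).2 _ (lt_min hδr (by positivity : (0 : ℝ) < sr / 4))] with n hn
      have hnr : (2 : ℝ)⁻¹ ^ k (φ n) < δr := hn.trans_le (min_le_left _ _)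
      have hns : (2 : ℝ)⁻¹ ^ k (φ n) < sr / 4 := hn.trans_le (min_le_right _ _)
      obtain ⟨hp, Hr'⟩ := Hr _ (hδ' n) hnr
      set d := (2 : ℝ)⁻¹ ^ k (φ n) with hd
      set y := nearestSite d w with hy
      have hρsr : ρ ≤ sr / 2 := (min_le_left _ _).trans (by linarith [hr'sr])
      have hwsr : dist w z < sr / 2 := by
        have : w ∈ ball z (sr / 2) := ball_subset_ball hρsr hw
        exact Metric.mem_ball.1 this
      have hyw : dist (meshPoint d y) w ≤ d := dist_meshPoint_nearestSite_le (hδ' n) w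
      have hnear : ∀ q : Site 2, dist (meshPoint d q) (meshPoint d y) ≤ d → meshPoint d q ∈ ball z sr := by
        intro q hq
        rw [Metric.mem_ball]
        linarith [dist_triangle (meshPoint d q) (meshPoint d y) z, dist_triangle (meshPoint d y) w z]
      have hyr : (dualGraph R.carrier d).Reachable (p₀ (φ n)) y := (Hr' y (hnear y (by rw [_root_.dist_self]; exact (hδ' n).le))).2
      have hI : ∀ kk : Fin 4, IsInnerSq R.carrier d (y + cornerUnit kk) := fun kk =>
        (Hr' _ (hnear _ (by rw [dist_meshPoint_adj (hδ' n).le (adj_of_stepKind (stepKind_add_cornerUnit y kk)).symm]))).1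
      have e0 := dualPot_step_eq R h0 (hδ' n) (hTsub (φ n)) (hBsub (φ n)) (hharm (φ n)) hp hyr 0 (hI 0)
      have e1 := dualPot_step_eq R h0 (hδ' n) (hTsub (φ n)) (hBsub (φ n)) (hharm (φ n)) hp hyr 1 (hI 1)
      simp only [crSgn, crOff, crDir, cornerUnit, Fin.isValue, ↓reduceIte, true_or, one_ne_zero, false_or,
        show ¬ ((1 : Fin 4) = 2) by decide, show ¬ ((1 : Fin 4) = 3) by decide] at e0 e1
      have hs0 : nearestSite d (w + d) = y + Pi.single 0 1 := nearestSite_add_right (hδ' n).ne' w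
      have hs1 : nearestSite d (w + d * Complex.I) = y + Pi.single 1 1 := nearestSite_add_up (hδ' n).ne' w
      have e0' : Hc (φ n) (y + Pi.single 0 1) - Hc (φ n) y =
          -1 * (h (φ n) (y + Pi.single 0 1) - h (φ n) (y + Pi.single 0 1 + Pi.single 1 1)) := e0
      have e1' : Hc (φ n) (y + Pi.single 1 1) - Hc (φ n) y =
          1 * (h (φ n) (y + Pi.single 1 1) - h (φ n) (y + Pi.single 1 1 + Pi.single 0 1)) := e1
      rw [hs0, hs1]
      exact ⟨by rw [e0']; ring, by rw [e1']; ring⟩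
    -- conclude by uniqueness of limits
    have hgu₀ : gu₀ w = g₁ z hz w := by
      refine tendsto_nhds_unique hlim₀ ?_
      exact hD1.congr' (hCRd.mono fun n hn => hn.1.symm)
    have hgu₁ : gu₁ w = -g₀ z hz w := by
      refine tendsto_nhds_unique hlim₁ ?_
      exact hD0.neg.congr' (hCRd.mono fun n hn => hn.2.symm)
    have := hFu w hw8
    rwa [hgu₀, hgu₁] at this
  -- ### the holomorphic function
  choose ρ hρ hρs hFu using hCR
  set f : ℂ → ℂ := fun w => (u w : ℂ) + (v w : ℂ) * Complex.I with hf
  have hderiv : ∀ z (hz : z ∈ R.carrier), HasDerivAt f ((g₁ z hz z : ℂ) + (g₀ z hz z : ℂ) * Complex.I) z := fun z hz =>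
    hasDerivAt_of_cr (hFu z hz z (mem_ball_self (hρ z hz))) (hF z hz z (mem_ball_self (hs z hz)))
  have hdiff : DifferentiableOn ℂ f R.carrier := fun z hz => (hderiv z hz).differentiableAt.differentiableWithinAt
  have hnorm : ∀ z ∈ R.carrier, ‖deriv f z‖ₑ = ‖fderiv ℝ v z‖ₑ := by
    intro z hz
    rw [(hderiv z hz).deriv, hfd z hz z (mem_ball_self (hs z hz)), enorm_eq_nnnorm, enorm_eq_nnnorm]
    congr 1
    ext
    rw [coe_nnnorm, coe_nnnorm, norm_smul_reCLM_add_smul_imCLM]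
    have e : ((g₁ z hz z : ℂ) + (g₀ z hz z : ℂ) * Complex.I) = ⟨g₁ z hz z, g₀ z hz z⟩ := by
      apply Complex.ext <;> simp
    rw [e, Complex.norm_def, Complex.norm_def, Complex.normSq_mk, Complex.normSq_mk, add_comm]
  refine ⟨f, hdiff, ?_, fun z hz => ?_⟩
  · calc ∫⁻ w in R.carrier, ‖deriv f w‖ₑ ^ 2 = ∫⁻ w in R.carrier, ‖fderiv ℝ v w‖ₑ ^ 2 :=
          setLIntegral_congr_fun hΩo.measurableSet fun w hw => by rw [hnorm w hw]
      _ ≤ I := hint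
  · obtain ⟨s', hs', hconv, -⟩ := hU z hz
    refine ⟨s', hs', hconv.congr_right fun w _ => ?_⟩
    simp [hf]

end HoloLimit

end SquareTiling

end Literature.Probability.LatticeModels
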